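import Literature.Analysis.FluidPDE.SelfSimilarEulerLpExclusion
import Literature.Analysis.FluidPDE.WholeSpaceIBP
import Literature.Analysis.Calculus.SmoothCutoff
import Literature.Analysis.FluidPDE.SteadyNSCaccioppoliTools
import HarnessLib

/-!
# Chae–Shvydkoy 2013, Theorem 3.2 at `p = 3`, proved: no `L³` self-similar Euler collapse profile
# with `L^{3/2}` pressure outside the window `1 < α ≤ 3/2`

Analysis/FluidPDE proof file (theorems only; no definitions, no named facts, no `sorry`) in the
story of `SelfSimilarEulerLpExclusion.lean`, which vendors

* D. Chae, R. Shvydkoy, *On formation of a locally self-similar collapse in the incompressible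
  Euler equations*, Arch. Ration. Mech. Anal. **209** (2013) 999–1017 = arXiv:1201.6009
  [ChaeShvydkoy2013], Theorem 3.2,

as the NAMED FACT `chaeShvydkoy2013_Lp_exclusion` (all `3 ≤ p < ∞`). Here the case **`p = 3`**
— "This includes the `L³` case natural for the Navier–Stokes equations" (CS13 abstract), the
case used by route `EulerZoomLiouville` through `chaeShvydkoy2013_Lp_exclusion.of_rieszPressure`
— is PROVED, following the printed proof (§2.2, §3.2.1–§3.2.2):

1. `IsSelfSimilarEulerProfile.localEnergy_identity` — the local energy equality in profile
   variables (CS13 (2.11)–(2.13)): testing the tree's profile equation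
   `(1−γ)U + DU(y)[γy + U] + ∇P = 0`, `γ = 1/(α+1)`, against `φU` and integrating by parts
   (`WholeSpaceIBP.lean`) gives, for every `φ ∈ C¹_c`,
   `(2α−3)∫φ|U|² − ∫(Dφ·y)|U|² = (1+α)∫(|U|²+2P)(Dφ·U)`;
   `…_radial` is its form for `φ = Φ(|y|²)`.
2. Range `α > 3/2` (§3.2.2), `eq_zero_of_memLp_three_of_gt_three_halves`: with the radial
   cut-off `Φ(t) = σ(2 − 2t/L²)` (`σ = Real.smoothTransition`, `Φ' ≤ 0`) the identity gives
   `(2α−3)∫_{|y|<L/2}|U|² ≤ (1+α)(4D/L)∫(|U|³+2|P||U|)`, so ball energies are `O(1/L)`.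
3. Range `−1 < α ≤ 1 = N/p` (§3.2.1), `eq_zero_of_memLp_three_of_le_one`: CS13's integrated
   family of cut-offs `∫ l^{2α−4}σ(y/l) dl` ((2.13)→(3.2)) is realised by ONE test function
   `Φ = Φ₁Φ₂`, `Φ₁(t) = ψ_β(t/l₁²)` with `ψ_β(s) = 1 + σ(s−1)((s/2)^{−β} − 1)`, `β = 3/2 − α`
   (so `t^βΦ₁` is nondecreasing, `Φ₁ = 1` on `|y| ≤ l₁`, `Φ₁ ~ |y|^{2α−3}` beyond) and the outer
   cut-off `Φ₂` at scale `l₂`; the identity yields the two-scale inequality `twoScale_ineq`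
   `(3−2α)∫_{|y|<l₁}|U|² ≤ 8Dl₁v₁^{1/3}(∫_{|y|²≥l₂²/2}|U|³)^{2/3} + (1+α)K/l₁ ∫(|U|³+2|P||U|)`,
   whose large-scale term is `o(1)` as `l₂ → ∞` exactly because `α ≤ 1` (the `L³`-scaling
   `α = N/p`); hence again ball energies are `O(1/l₁)`.
   Both ranges close with the tree's `eq_zero_of_energyGrowth_of_three_halves_lt` (exponent `2`).
4. `chaeShvydkoy2013_L3_exclusion` (both ranges), `chaeShvydkoy2013_Lp_exclusion_three` (the
   `p = 3` instance of the fact's body, verbatim) and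
   `IsSelfSimilarEulerProfile.eq_zero_of_memLp_three_of_rieszPressure` (the unconditional form of
   `chaeShvydkoy2013_Lp_exclusion.of_rieszPressure`, pressure `P = Π[U]` a.e.).
5. In Constantin–Ignatova–Vicol's vocabulary (`SelfSimilarEulerProfile.lean`):
   `HasSelfSimilarFarFieldWith.memLp_three` (the far field (3.8) is `L³` iff `γ < 1/2`) and
   `IsSelfSimilarEulerProfile.eq_zero_of_farField_of_lt_two_fifths` (`γ < 2/5` + (3.8) +
   associated pressure ⇒ trivial profile; primed form with `P ∈ L^{3/2}`).
6. **Corollary 3.4 at `p = 3` in the open window `1 < α < 3/2`** (§3.2.3):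
   `IsSelfSimilarEulerProfile.annular_energy_le_of_window` (for `1 ≤ α ≤ 3/2`:
   `∫_{L/4 ≤ |y| ≤ L/2} |U|² ≤ C L^{3−2α}`, from the identity with the inner profile at the fixed
   scale `1/2` and the polynomial outer profile `((1 − t/L²)₊)²`, whose derivative is bounded
   BELOW on `t ≤ L²/2` — the large-scale term now has the favourable sign) and
   `IsSelfSimilarEulerProfile.energyGrowth_of_memLp_three_of_window` (dyadic summation,
   `3 − 2α > 0`): `∫_{|y|<L} |U|² ≤ C L^{3−2α}` for `L ≥ L₀` — CS13 (3.20). The endpoint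
   `α = 3/2` (logarithm, CS13 §3.2.3) and `p > 3` stay in the named fact
   `chaeShvydkoy2013_energy_growth`.

At `p = 3` no bootstrap is needed (`β₃ = N − 1 − 3N/p = −1 < 0`, CS13 (3.3)) and therefore the
associated-pressure formula (2.3) / pressure-growth Lemma 3.3 are not used: `P ∈ L^{3/2}` and the
profile equation suffice (the Poisson equation `ΔP = −∂ᵢ∂ⱼ(UᵢUⱼ)` follows from the profile
equation anyway). Deliberately NOT here: `3 < p < ∞` (needs Lemma 3.3, localised Calderón–Zygmund
bounds for `ℛᵢℛⱼ(UᵢUⱼ)`), Cor. 3.4 at the endpoint `α = N/2` and for `p > 3`, Thm. 4.1 — they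
remain the named facts of `SelfSimilarEulerLpExclusion.lean`.

## Mathlib / tree search

Reused: `IsSelfSimilarEulerProfile`, `eq_zero_of_energyGrowth_of_three_halves_lt`,
`rieszPressure`/`memLp_rieszPressure` (`SelfSimilarEulerLpExclusion.lean` and its imports);
`integral_inner_convect_add_eq_zero`, `integral_inner_gradient_eq_neg_integral_mul_divergence`,
`divergence_smul_apply` (`WholeSpaceIBP.lean`); `fderiv_comp_norm_sq_apply`
(`RadialCalculus.lean`); `setIntegral_norm_sq_le_rpow_three` (`SteadyNSCaccioppoliTools.lean`);
`Calculus.exists_bound_deriv_smoothTransition`, `Calculus.deriv_smoothTransition_of_nonpos/of_one_le`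
(`Calculus/SmoothCutoff.lean`); Mathlib `Real.smoothTransition` (+ `.monotone.deriv_nonneg`),
`hasStrictFDerivAt_norm_sq`, `tendsto_setIntegral_of_antitone`, `Measure.addHaar_real_closedBall'`,
`norm_integral_le_of_norm_le`, `MemLp.integrable_norm_rpow`, `MemLp.integrable_mul`.
No new definitions, no instances, no notation.
-/

noncomputable section

open MeasureTheory Set Filter Topology Metric InnerProductSpace
open scoped RealInnerProductSpace ENNReal NNReal Laplacian

namespace Literature.Analysis.FluidPDE

/-! ## Pointwise calculus helpers -/

/-- `div (y ↦ y) = 3` on `ℝ³`. [folklore] -/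
private theorem divergence_id_eq_three (y : EuclideanSpace ℝ (Fin 3)) :
    VectorCalculus.divergence (fun x : EuclideanSpace ℝ (Fin 3) => x) y = 3 := by
  rw [VectorCalculus.divergence, fderiv_fun_id]
  have := LinearMap.trace_id ℝ (EuclideanSpace ℝ (Fin 3))
  rw [finrank_euclideanSpace_fin] at this
  exact_mod_cast this

/-- `⟪∇P(y), v⟫ = DP(y) v`. [folklore] -/
private theorem inner_gradient_left_eq_fderiv {P : EuclideanSpace ℝ (Fin 3) → ℝ}
    (y v : EuclideanSpace ℝ (Fin 3)) : ⟪gradient P y, v⟫ = fderiv ℝ P y v := by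
  rw [gradient, InnerProductSpace.toDual_symm_apply]

/-! ## The local energy identity of a self-similar profile (CS13 §2.2 in profile variables) -/

/-- **Local energy identity of a stationary self-similar Euler profile** (the profile-variable
form of Chae–Shvydkoy's basic energy balance, CS13 §2.2 (2.11)–(2.13): the Euler local energy
equality written in self-similar variables). For a `C²` profile `(U, P)` with exponent
`γ = 1/(α+1)` (tree convention `(1−γ)U + DU(y)[γ y + U(y)] + ∇P = 0`, `div U = 0`) and every
test function `φ ∈ C¹_c(ℝ³)`,
`(2α − 3) ∫ φ |U|² − ∫ (Dφ(y) y) |U|² = (1 + α) ∫ (|U|² + 2P) (Dφ(y) U(y))`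
(test the profile equation against `φ U` and integrate by parts: `∫ φ ⟪DU·y, U⟫ = −½∫ (Dφ·y)|U|²
− (3/2)∫ φ|U|²`, `∫ φ ⟪DU·U, U⟫ = −½ ∫ (Dφ·U)|U|²`, `∫ φ ⟪∇P, U⟫ = −∫ P (Dφ·U)`).
[cite: ChaeShvydkoy2013, §2.2 eq. (2.13)] -/
theorem IsSelfSimilarEulerProfile.localEnergy_identity {α : ℝ} (hα : α + 1 ≠ 0)
    {U : EuclideanSpace ℝ (Fin 3) → EuclideanSpace ℝ (Fin 3)} {P : EuclideanSpace ℝ (Fin 3) → ℝ}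
    (h : IsSelfSimilarEulerProfile (1 / (α + 1)) 0 U P)
    {φ : EuclideanSpace ℝ (Fin 3) → ℝ} (hφ : ContDiff ℝ 1 φ) (hφc : HasCompactSupport φ) :
    (2 * α - 3) * (∫ y, φ y * ‖U y‖ ^ 2) - ∫ y, fderiv ℝ φ y y * ‖U y‖ ^ 2 =
      (1 + α) * ∫ y, (‖U y‖ ^ 2 + 2 * P y) * fderiv ℝ φ y (U y) := by
  set γ : ℝ := 1 / (α + 1) with hγ_def
  have hγ : γ * (α + 1) = 1 := by rw [hγ_def]; field_simp
  have hU1 : ContDiff ℝ 1 U := h.contDiff_velocity.of_le one_le_two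
  have hUc : Continuous U := hU1.continuous
  have hDUc : Continuous (fderiv ℝ U) := hU1.continuous_fderiv one_ne_zero
  have hPc : Continuous P := h.contDiff_pressure.continuous
  have hφcont : Continuous φ := hφ.continuous
  have hDφc : Continuous (fderiv ℝ φ) := hφ.continuous_fderiv one_ne_zero
  -- the test field `w = φ U`
  set w : EuclideanSpace ℝ (Fin 3) → EuclideanSpace ℝ (Fin 3) := fun y => φ y • U y with hw_def
  have hw1 : ContDiff ℝ 1 w := hφ.smul hU1
  have hwc : HasCompactSupport w := hφc.smul_right
  have hDw : ∀ y v, fderiv ℝ w y v = φ y • fderiv ℝ U y v + (fderiv ℝ φ y v) • U y := by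
    intro y v
    rw [hw_def, fderiv_fun_smul (hφ.differentiable one_ne_zero y) (hU1.differentiable one_ne_zero y)]
    simp [ContinuousLinearMap.smulRight_apply]
  -- integrability of every `φ`-localised integrand
  have hint_φ : ∀ {g : EuclideanSpace ℝ (Fin 3) → ℝ}, Continuous g →
      Integrable (fun y => φ y * g y) (volume : Measure (EuclideanSpace ℝ (Fin 3))) :=
    fun hg => (hφcont.mul hg).integrable_of_hasCompactSupport hφc.mul_right
  have hint_Dφ : ∀ {v : EuclideanSpace ℝ (Fin 3) → EuclideanSpace ℝ (Fin 3)}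
      {g : EuclideanSpace ℝ (Fin 3) → ℝ}, Continuous v → Continuous g →
      Integrable (fun y => fderiv ℝ φ y (v y) * g y) (volume : Measure (EuclideanSpace ℝ (Fin 3))) := by
    intro v g hv hg
    refine ((hDφc.clm_apply hv).mul hg).integrable_of_hasCompactSupport ?_
    refine (hφc.fderiv (𝕜 := ℝ)).mono fun y hy => ?_
    contrapose! hy
    simp only [Function.mem_support, not_not] at hy ⊢
    simp [hy]
  -- (1) transport by `y`: `2∫ φ⟪DU·y, U⟫ + ∫ (Dφ·y)|U|² + 3∫ φ|U|² = 0`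
  have h1 := integral_inner_convect_add_eq_zero (u := fun y : EuclideanSpace ℝ (Fin 3) => y)
    (v := U) (w := w) contDiff_id hU1 hw1 hwc
  have h1a : (fun y => ⟪convect (fun y : EuclideanSpace ℝ (Fin 3) => y) U y, w y⟫) =
      fun y => φ y * ⟪fderiv ℝ U y y, U y⟫ := by
    funext y
    simp only [convect, hw_def, real_inner_smul_right]
  have h1b : (fun y => ⟪U y, convect (fun y : EuclideanSpace ℝ (Fin 3) => y) w y⟫) =
      fun y => φ y * ⟪fderiv ℝ U y y, U y⟫ + fderiv ℝ φ y y * ‖U y‖ ^ 2 := by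
    funext y
    simp only [convect, hDw, inner_add_right, real_inner_smul_right, real_inner_self_eq_norm_sq,
      real_inner_comm (U y)]
  have h1c : (fun y => VectorCalculus.divergence (fun y : EuclideanSpace ℝ (Fin 3) => y) y *
      ⟪U y, w y⟫) = fun y => 3 * (φ y * ‖U y‖ ^ 2) := by
    funext y
    simp only [divergence_id_eq_three, hw_def, real_inner_smul_right, real_inner_self_eq_norm_sq]
  rw [h1a, h1b, h1c] at h1
  have hiA : Integrable (fun y => φ y * ⟪fderiv ℝ U y y, U y⟫)
      (volume : Measure (EuclideanSpace ℝ (Fin 3))) :=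
    hint_φ ((hDUc.clm_apply continuous_id).inner hUc)
  have hiB : Integrable (fun y => fderiv ℝ φ y y * ‖U y‖ ^ 2)
      (volume : Measure (EuclideanSpace ℝ (Fin 3))) :=
    hint_Dφ continuous_id (hUc.norm.pow 2)
  have hiE : Integrable (fun y => φ y * ‖U y‖ ^ 2) (volume : Measure (EuclideanSpace ℝ (Fin 3))) :=
    hint_φ (hUc.norm.pow 2)
  rw [integral_add hiA hiB, integral_const_mul] at h1
  -- (2) transport by `U` (`div U = 0`): `2∫ φ⟪DU·U, U⟫ + ∫ (Dφ·U)|U|² = 0`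
  have h2 := integral_inner_convect_add_eq_zero (u := U) (v := U) (w := w) hU1 hU1 hw1 hwc
  have h2a : (fun y => ⟪convect U U y, w y⟫) = fun y => φ y * ⟪fderiv ℝ U y (U y), U y⟫ := by
    funext y
    simp only [convect, hw_def, real_inner_smul_right]
  have h2b : (fun y => ⟪U y, convect U w y⟫) =
      fun y => φ y * ⟪fderiv ℝ U y (U y), U y⟫ + fderiv ℝ φ y (U y) * ‖U y‖ ^ 2 := by
    funext y
    simp only [convect, hDw, inner_add_right, real_inner_smul_right, real_inner_self_eq_norm_sq,
      real_inner_comm (U y)]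
  have h2c : (fun y => VectorCalculus.divergence U y * ⟪U y, w y⟫) = fun _ => 0 := by
    funext y
    rw [h.divFree y, zero_mul]
  rw [h2a, h2b, h2c, integral_zero, add_zero] at h2
  have hiC : Integrable (fun y => φ y * ⟪fderiv ℝ U y (U y), U y⟫)
      (volume : Measure (EuclideanSpace ℝ (Fin 3))) :=
    hint_φ ((hDUc.clm_apply hUc).inner hUc)
  have hiD : Integrable (fun y => fderiv ℝ φ y (U y) * ‖U y‖ ^ 2)
      (volume : Measure (EuclideanSpace ℝ (Fin 3))) :=
    hint_Dφ hUc (hUc.norm.pow 2)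
  rw [integral_add hiC hiD] at h2
  -- (3) pressure: `∫ φ⟪∇P, U⟫ = -∫ P (Dφ·U)`
  have h3 := integral_inner_gradient_eq_neg_integral_mul_divergence (p := P) (ψ := w)
    h.contDiff_pressure hw1 hwc
  have h3a : (fun y => ⟪gradient P y, w y⟫) = fun y => φ y * fderiv ℝ P y (U y) := by
    funext y
    simp only [hw_def, real_inner_smul_right, inner_gradient_left_eq_fderiv]
  have h3b : (fun y => P y * VectorCalculus.divergence w y) = fun y => fderiv ℝ φ y (U y) * P y := by
    funext y
    rw [hw_def, divergence_smul_apply (hφ.differentiable one_ne_zero y) (hU1.differentiable one_ne_zero y),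
      h.divFree y, mul_zero, zero_add, real_inner_comm, inner_gradient_left_eq_fderiv]
    ring
  rw [h3a, h3b] at h3
  -- (4) the profile equation tested against `φ U`
  have h4pt : ∀ y, (1 - γ) * (φ y * ‖U y‖ ^ 2) + γ * (φ y * ⟪fderiv ℝ U y y, U y⟫) +
      φ y * ⟪fderiv ℝ U y (U y), U y⟫ + φ y * fderiv ℝ P y (U y) = 0 := by
    intro y
    have he := congrArg (fun v => φ y * ⟪v, U y⟫) (h.profile_eq y)
    simp only [sub_zero, map_add, map_smul, inner_add_left, inner_smul_left, inner_zero_left,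
      mul_zero, real_inner_self_eq_norm_sq, RCLike.conj_to_real, inner_gradient_left_eq_fderiv] at he
    linear_combination he
  have hiF : Integrable (fun y => φ y * fderiv ℝ P y (U y))
      (volume : Measure (EuclideanSpace ℝ (Fin 3))) :=
    hint_φ ((h.contDiff_pressure.continuous_fderiv one_ne_zero).clm_apply hUc)
  have h4' : ∫ y, ((1 - γ) * (φ y * ‖U y‖ ^ 2) + γ * (φ y * ⟪fderiv ℝ U y y, U y⟫) +
      φ y * ⟪fderiv ℝ U y (U y), U y⟫ + φ y * fderiv ℝ P y (U y)) = 0 := by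
    simp_rw [h4pt]
    exact integral_zero _ _
  have h4 : (1 - γ) * (∫ y, φ y * ‖U y‖ ^ 2) + γ * (∫ y, φ y * ⟪fderiv ℝ U y y, U y⟫) +
      (∫ y, φ y * ⟪fderiv ℝ U y (U y), U y⟫) + ∫ y, φ y * fderiv ℝ P y (U y) = 0 := by
    rw [integral_add (((hiE.const_mul _).fun_add (hiA.const_mul _)).fun_add hiC) hiF,
      integral_add ((hiE.const_mul _).fun_add (hiA.const_mul _)) hiC,
      integral_add (hiE.const_mul _) (hiA.const_mul _), integral_const_mul, integral_const_mul] at h4'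
    exact h4'
  -- the right-hand side splits
  have hiG : Integrable (fun y => fderiv ℝ φ y (U y) * P y)
      (volume : Measure (EuclideanSpace ℝ (Fin 3))) := hint_Dφ hUc hPc
  have hR : ∫ y, (‖U y‖ ^ 2 + 2 * P y) * fderiv ℝ φ y (U y) =
      (∫ y, fderiv ℝ φ y (U y) * ‖U y‖ ^ 2) + 2 * ∫ y, fderiv ℝ φ y (U y) * P y := by
    rw [← integral_const_mul, ← integral_add hiD (hiG.const_mul _)]
    refine integral_congr_ae (Eventually.of_forall fun y => ?_)
    simp only
    ring
  rw [hR]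
  -- assemble: multiply (4) by `2(α+1)` and substitute (1)–(3)
  linear_combination (2 * (α + 1)) * h4 - h1 - (α + 1) * h2 - (2 * (α + 1)) * h3 +
    (2 * (∫ y, φ y * ‖U y‖ ^ 2) - 2 * ∫ y, φ y * ⟪fderiv ℝ U y y, U y⟫) * hγ

/-! ## Radial test functions `φ(y) = Φ(|y|²)` -/

/-- A radial function `Φ(|y|²)` with `Φ = 0` on `[T, ∞)` has compact support. [folklore] -/
private theorem hasCompactSupport_comp_norm_sq {Φ : ℝ → ℝ} {T : ℝ} (hT : ∀ t, T ≤ t → Φ t = 0) :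
    HasCompactSupport (fun y : EuclideanSpace ℝ (Fin 3) => Φ (‖y‖ ^ 2)) := by
  refine HasCompactSupport.intro (isCompact_closedBall (0 : EuclideanSpace ℝ (Fin 3))
    (Real.sqrt (max T 0))) fun y hy => ?_
  rw [mem_closedBall_zero_iff, not_le] at hy
  apply hT
  have h0 : 0 ≤ Real.sqrt (max T 0) := Real.sqrt_nonneg _
  have h1 : max T 0 < ‖y‖ ^ 2 := by
    calc max T 0 = Real.sqrt (max T 0) ^ 2 := (Real.sq_sqrt (le_max_right _ _)).symm
      _ < ‖y‖ ^ 2 := by gcongr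
  exact ((le_max_left _ _).trans_lt h1).le

/-- **The local energy identity for radial tests.** For a `C¹` function `Φ` vanishing on `[T, ∞)`
and the test function `φ(y) = Φ(|y|²)` (so `Dφ(y) y = 2|y|²Φ'(|y|²)`, `Dφ(y) U = 2Φ'(|y|²)⟪y, U⟫`),
the identity `localEnergy_identity` reads
`∫ ((2α−3)Φ(|y|²) − 2|y|²Φ'(|y|²)) |U|² = (1+α) ∫ (|U|²+2P) · 2Φ'(|y|²)⟪y, U⟫`
(CS13 use the radial tests `σ(y/l)`, §2.2). [cite: ChaeShvydkoy2013, §2.2 eq. (2.13)] -/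
theorem IsSelfSimilarEulerProfile.localEnergy_identity_radial {α : ℝ} (hα : α + 1 ≠ 0)
    {U : EuclideanSpace ℝ (Fin 3) → EuclideanSpace ℝ (Fin 3)} {P : EuclideanSpace ℝ (Fin 3) → ℝ}
    (h : IsSelfSimilarEulerProfile (1 / (α + 1)) 0 U P)
    {Φ : ℝ → ℝ} (hΦ : ContDiff ℝ 1 Φ) {T : ℝ} (hT : ∀ t, T ≤ t → Φ t = 0) :
    ∫ y, ((2 * α - 3) * Φ (‖y‖ ^ 2) - 2 * ‖y‖ ^ 2 * deriv Φ (‖y‖ ^ 2)) * ‖U y‖ ^ 2 =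
      (1 + α) * ∫ y, (‖U y‖ ^ 2 + 2 * P y) * (2 * deriv Φ (‖y‖ ^ 2) * ⟪y, U y⟫) := by
  have hΦd : Differentiable ℝ Φ := hΦ.differentiable one_ne_zero
  have hφ : ContDiff ℝ 1 (fun y : EuclideanSpace ℝ (Fin 3) => Φ (‖y‖ ^ 2)) :=
    hΦ.comp (contDiff_norm_sq ℝ)
  have hφc := hasCompactSupport_comp_norm_sq (Φ := Φ) hT
  have key := h.localEnergy_identity hα hφ hφc
  have hD : ∀ y v : EuclideanSpace ℝ (Fin 3),
      fderiv ℝ (fun y : EuclideanSpace ℝ (Fin 3) => Φ (‖y‖ ^ 2)) y v =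
        2 * deriv Φ (‖y‖ ^ 2) * ⟪y, v⟫ := fun y v =>
    fderiv_comp_norm_sq_apply (hΦd _).hasDerivAt v
  simp_rw [hD, real_inner_self_eq_norm_sq] at key
  rw [← key]
  -- combine the two integrals on the left
  have hUc : Continuous U := h.contDiff_velocity.continuous
  have hΦc : Continuous fun y : EuclideanSpace ℝ (Fin 3) => Φ (‖y‖ ^ 2) := hφ.continuous
  have hΦ'c : Continuous fun y : EuclideanSpace ℝ (Fin 3) => deriv Φ (‖y‖ ^ 2) :=
    (hΦ.continuous_deriv_one).comp (continuous_norm.pow 2)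
  have hTd : ∀ t, T < t → deriv Φ t = 0 := by
    intro t ht
    have hev : Φ =ᶠ[𝓝 t] fun _ => 0 := by
      filter_upwards [Ioi_mem_nhds ht] with s hs using hT s (le_of_lt hs)
    rw [hev.deriv_eq, deriv_const]
  have hφ'c : HasCompactSupport fun y : EuclideanSpace ℝ (Fin 3) => deriv Φ (‖y‖ ^ 2) :=
    hasCompactSupport_comp_norm_sq (Φ := deriv Φ) (T := T + 1) fun t ht => hTd t (by linarith)
  have hi1 : Integrable (fun y : EuclideanSpace ℝ (Fin 3) => Φ (‖y‖ ^ 2) * ‖U y‖ ^ 2) :=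
    (hΦc.mul (hUc.norm.pow 2)).integrable_of_hasCompactSupport hφc.mul_right
  have hi2 : Integrable (fun y : EuclideanSpace ℝ (Fin 3) =>
      2 * deriv Φ (‖y‖ ^ 2) * ‖y‖ ^ 2 * ‖U y‖ ^ 2) := by
    have : Integrable (fun y : EuclideanSpace ℝ (Fin 3) =>
        deriv Φ (‖y‖ ^ 2) * (2 * ‖y‖ ^ 2 * ‖U y‖ ^ 2)) :=
      (hΦ'c.mul ((continuous_const.mul (continuous_norm.pow 2)).mul (hUc.norm.pow 2)))
        |>.integrable_of_hasCompactSupport hφ'c.mul_right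
    refine this.congr (Eventually.of_forall fun y => ?_)
    simp only
    ring
  rw [← integral_const_mul, ← integral_sub (hi1.const_mul _) hi2]
  refine integral_congr_ae (Eventually.of_forall fun y => ?_)
  simp only
  ring

/-! ## The outer cut-off `Φ_a(t) = smoothTransition (2 − 2t/a)` -/

/-- The outer cut-off profile `t ↦ σ(2 − 2t/a)` (`= 1` for `t ≤ a/2`, `= 0` for `t ≥ a`,
nonincreasing) is smooth. [folklore] -/
private theorem outerCut_contDiff (a : ℝ) {n : ℕ∞} :
    ContDiff ℝ n fun t : ℝ => Real.smoothTransition (2 - 2 / a * t) :=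
  Real.smoothTransition.contDiff.comp ((contDiff_const).sub (contDiff_const.mul contDiff_id))

/-- Auxiliary computation. [folklore] -/
private theorem outerCut_eq_one {a t : ℝ} (ha : 0 < a) (ht : t ≤ a / 2) :
    Real.smoothTransition (2 - 2 / a * t) = 1 := by
  apply Real.smoothTransition.one_of_one_le
  have : 2 / a * t ≤ 2 / a * (a / 2) := by gcongr
  have h2 : 2 / a * (a / 2) = 1 := by field_simp
  linarith

/-- Auxiliary computation. [folklore] -/
private theorem outerCut_eq_zero {a t : ℝ} (ha : 0 < a) (ht : a ≤ t) :
    Real.smoothTransition (2 - 2 / a * t) = 0 := by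
  apply Real.smoothTransition.zero_of_nonpos
  have : 2 / a * a ≤ 2 / a * t := by gcongr
  have h2 : 2 / a * a = 2 := by field_simp
  linarith

/-- Auxiliary computation. [folklore] -/
private theorem outerCut_nonneg (a t : ℝ) : 0 ≤ Real.smoothTransition (2 - 2 / a * t) :=
  Real.smoothTransition.nonneg _

/-- Auxiliary computation. [folklore] -/
private theorem outerCut_le_one (a t : ℝ) : Real.smoothTransition (2 - 2 / a * t) ≤ 1 :=
  Real.smoothTransition.le_one _

/-- Auxiliary computation. [folklore] -/
private theorem outerCut_hasDerivAt (a t : ℝ) :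
    HasDerivAt (fun t : ℝ => Real.smoothTransition (2 - 2 / a * t))
      (deriv Real.smoothTransition (2 - 2 / a * t) * (-(2 / a))) t := by
  have h1 : HasDerivAt (fun t : ℝ => 2 - 2 / a * t) (-(2 / a)) t := by
    simpa using ((hasDerivAt_id t).const_mul (2 / a)).const_sub 2
  exact (Calculus.differentiable_smoothTransition _).hasDerivAt.comp t h1

/-- Auxiliary computation. [folklore] -/
private theorem outerCut_deriv (a t : ℝ) :
    deriv (fun t : ℝ => Real.smoothTransition (2 - 2 / a * t)) t =
      deriv Real.smoothTransition (2 - 2 / a * t) * (-(2 / a)) :=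
  (outerCut_hasDerivAt a t).deriv

/-- Auxiliary computation. [folklore] -/
private theorem outerCut_deriv_nonpos {a : ℝ} (ha : 0 < a) (t : ℝ) :
    deriv (fun t : ℝ => Real.smoothTransition (2 - 2 / a * t)) t ≤ 0 := by
  rw [outerCut_deriv]
  have h1 : 0 ≤ deriv Real.smoothTransition (2 - 2 / a * t) :=
    Real.smoothTransition.monotone.deriv_nonneg
  have h2 : 0 < 2 / a := by positivity
  nlinarith

/-- Auxiliary computation. [folklore] -/
private theorem outerCut_deriv_eq_zero_of_le {a t : ℝ} (ha : 0 < a) (ht : a ≤ t) :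
    deriv (fun t : ℝ => Real.smoothTransition (2 - 2 / a * t)) t = 0 := by
  rw [outerCut_deriv, Calculus.deriv_smoothTransition_of_nonpos, zero_mul]
  have : 2 / a * a ≤ 2 / a * t := by gcongr
  have h2 : 2 / a * a = 2 := by field_simp
  linarith

/-- Auxiliary computation. [folklore] -/
private theorem outerCut_deriv_eq_zero_of_le_half {a t : ℝ} (ha : 0 < a) (ht : t ≤ a / 2) :
    deriv (fun t : ℝ => Real.smoothTransition (2 - 2 / a * t)) t = 0 := by
  rw [outerCut_deriv, Calculus.deriv_smoothTransition_of_one_le, zero_mul]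
  have : 2 / a * t ≤ 2 / a * (a / 2) := by gcongr
  have h2 : 2 / a * (a / 2) = 1 := by field_simp
  linarith

/-- `|Φ_a'(t)| ≤ 2D/a` where `D` bounds `|smoothTransition'|`. [folklore] -/
private theorem abs_outerCut_deriv_le {a : ℝ} (ha : 0 < a) {D : ℝ}
    (hD : ∀ s, |deriv Real.smoothTransition s| ≤ D) (t : ℝ) :
    |deriv (fun t : ℝ => Real.smoothTransition (2 - 2 / a * t)) t| ≤ 2 * D / a := by
  rw [outerCut_deriv, abs_mul, abs_neg, abs_of_pos (by positivity : (0 : ℝ) < 2 / a)]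
  calc |deriv Real.smoothTransition (2 - 2 / a * t)| * (2 / a) ≤ D * (2 / a) := by
        gcongr
        exact hD _
    _ = 2 * D / a := by ring

/-! ## Theorem 3.2 at `p = 3` in the range `α > 3/2` -/

/-- The flux integrand `|U|³ + 2|P||U|` of an `L³` field with `L^{3/2}` pressure is integrable
(Hölder `3/2, 3`). [folklore] -/
private theorem integrable_flux {U : EuclideanSpace ℝ (Fin 3) → EuclideanSpace ℝ (Fin 3)}
    {P : EuclideanSpace ℝ (Fin 3) → ℝ} (hU3 : MemLp U 3 volume) (hP : MemLp P (3 / 2 : ℝ≥0∞) volume) :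
    Integrable (fun y => ‖U y‖ ^ 3 + 2 * (|P y| * ‖U y‖))
      (volume : Measure (EuclideanSpace ℝ (Fin 3))) := by
  have h1 : Integrable (fun y => ‖U y‖ ^ 3) (volume : Measure (EuclideanSpace ℝ (Fin 3))) := by
    have := hU3.integrable_norm_rpow (by norm_num) (by norm_num)
    refine this.congr (Eventually.of_forall fun y => ?_)
    simp only [ENNReal.toReal_ofNat]
    exact_mod_cast Real.rpow_natCast ‖U y‖ 3
  haveI : ENNReal.HolderTriple (3 / 2) 3 1 := by
    have h23 : (2 : ℝ≥0∞) / 3 + 3⁻¹ = 1 := by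
      rw [show (3 : ℝ≥0∞)⁻¹ = 1 / 3 by rw [one_div], ENNReal.div_add_div_same,
        show (2 : ℝ≥0∞) + 1 = 3 by norm_num]
      exact ENNReal.div_self (by norm_num) (by norm_num)
    constructor
    rw [ENNReal.inv_div (Or.inr (by norm_num)) (Or.inr (by norm_num)), inv_one, h23]
  have h2 : Integrable (fun y => |P y| * ‖U y‖) (volume : Measure (EuclideanSpace ℝ (Fin 3))) := by
    have := MemLp.integrable_mul hP.norm hU3.norm
    refine this.congr (Eventually.of_forall fun y => ?_)
    simp [Real.norm_eq_abs]
  exact h1.add (h2.const_mul 2)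

/-- **Chae–Shvydkoy 2013, Theorem 3.2 at `p = 3`, energy-supercritical range `α > 3/2`,
proved.** A stationary self-similar Euler profile `(U, P)` with exponent `γ = 1/(α+1)`,
`α > 3/2`, `U ∈ C² ∩ L³(ℝ³)` and `P ∈ L^{3/2}(ℝ³)` is trivial. Proof (CS13 §3.2.2 at `p = 3`):
the radial local energy identity with the cut-off `Φ(|y|²)`, `Φ(t) = σ(2 − 2t/L²)`
(`= 1` on `|y| ≤ L/√2`, `= 0` off `|y| ≤ L`, `Φ' ≤ 0`) gives
`(2α−3) ∫_{|y|<L/2} |U|² ≤ (1+α) · (4D/L) ∫ (|U|³ + 2|P||U|)`, i.e. ball energies `≲ 1/L → 0`.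
The associated-pressure formula (2.3) is not needed in this range at `p = 3` (only
`P ∈ L^{3/2}`). [cite: ChaeShvydkoy2013, §3.2.2 (Thm. 3.2, range α > N/2, p = 3)] -/
theorem IsSelfSimilarEulerProfile.eq_zero_of_memLp_three_of_gt_three_halves {α : ℝ}
    {U : EuclideanSpace ℝ (Fin 3) → EuclideanSpace ℝ (Fin 3)} {P : EuclideanSpace ℝ (Fin 3) → ℝ}
    (h : IsSelfSimilarEulerProfile (1 / (α + 1)) 0 U P) (hα : 3 / 2 < α)
    (hU3 : MemLp U 3 volume) (hP : MemLp P (3 / 2 : ℝ≥0∞) volume) : U = 0 := by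
  have hα1 : α + 1 ≠ 0 := by
    intro h0
    linarith
  have hUc : Continuous U := h.contDiff_velocity.continuous
  obtain ⟨D, hD0, hD⟩ := Calculus.exists_bound_deriv_smoothTransition
  set If : ℝ := ∫ y, (‖U y‖ ^ 3 + 2 * (|P y| * ‖U y‖)) with hIf_def
  have hIf : 0 ≤ If := integral_nonneg fun y => by positivity
  have hflux := integrable_flux hU3 hP
  -- ball energies decay like `1/L`
  have hball : ∀ L : ℝ, 0 < L →
      ∫ y in ball (0 : EuclideanSpace ℝ (Fin 3)) (L / 2), ‖U y‖ ^ 2 ≤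
        (1 + α) * (4 * D * If) / (2 * α - 3) / L := by
    intro L hL
    set a : ℝ := L ^ 2 with ha_def
    have ha : 0 < a := by positivity
    set Φ : ℝ → ℝ := fun t => Real.smoothTransition (2 - 2 / a * t) with hΦ_def
    have hΦ1 : ContDiff ℝ 1 Φ := outerCut_contDiff a
    have hΦT : ∀ t, a ≤ t → Φ t = 0 := fun t ht => outerCut_eq_zero ha ht
    have key := h.localEnergy_identity_radial hα1 hΦ1 hΦT
    -- lower bound of the left-hand side
    have hκ : ∀ y : EuclideanSpace ℝ (Fin 3),
        (2 * α - 3) * (ball (0 : EuclideanSpace ℝ (Fin 3)) (L / 2)).indicator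
            (fun y => ‖U y‖ ^ 2) y ≤
          ((2 * α - 3) * Φ (‖y‖ ^ 2) - 2 * ‖y‖ ^ 2 * deriv Φ (‖y‖ ^ 2)) * ‖U y‖ ^ 2 := by
      intro y
      have hd : deriv Φ (‖y‖ ^ 2) ≤ 0 := outerCut_deriv_nonpos ha _
      have hΦ0 : 0 ≤ Φ (‖y‖ ^ 2) := outerCut_nonneg a _
      have h2 : 0 ≤ -(2 * ‖y‖ ^ 2 * deriv Φ (‖y‖ ^ 2)) * ‖U y‖ ^ 2 := by
        have : 0 ≤ -deriv Φ (‖y‖ ^ 2) := by linarith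
        have h' : 0 ≤ 2 * ‖y‖ ^ 2 * (-deriv Φ (‖y‖ ^ 2)) := by positivity
        nlinarith [sq_nonneg ‖U y‖]
      by_cases hy : y ∈ ball (0 : EuclideanSpace ℝ (Fin 3)) (L / 2)
      · rw [indicator_of_mem hy]
        have hy' : ‖y‖ ^ 2 ≤ a / 2 := by
          rw [mem_ball_zero_iff] at hy
          have : ‖y‖ ^ 2 < (L / 2) ^ 2 := by
            gcongr
          nlinarith
        rw [show Φ (‖y‖ ^ 2) = 1 from outerCut_eq_one ha hy']
        nlinarith
      · rw [indicator_of_notMem hy, mul_zero]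
        have h3 : 0 ≤ (2 * α - 3) * Φ (‖y‖ ^ 2) * ‖U y‖ ^ 2 := by
          have : 0 ≤ 2 * α - 3 := by linarith
          positivity
        nlinarith
    have hiL : Integrable (fun y => ((2 * α - 3) * Φ (‖y‖ ^ 2) -
        2 * ‖y‖ ^ 2 * deriv Φ (‖y‖ ^ 2)) * ‖U y‖ ^ 2)
        (volume : Measure (EuclideanSpace ℝ (Fin 3))) := by
      have hc : Continuous fun y : EuclideanSpace ℝ (Fin 3) => ((2 * α - 3) * Φ (‖y‖ ^ 2) -
          2 * ‖y‖ ^ 2 * deriv Φ (‖y‖ ^ 2)) * ‖U y‖ ^ 2 := by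
        have h1 : Continuous fun y : EuclideanSpace ℝ (Fin 3) => Φ (‖y‖ ^ 2) :=
          hΦ1.continuous.comp (continuous_norm.pow 2)
        have h2 : Continuous fun y : EuclideanSpace ℝ (Fin 3) => deriv Φ (‖y‖ ^ 2) :=
          hΦ1.continuous_deriv_one.comp (continuous_norm.pow 2)
        exact ((continuous_const.mul h1).sub
          ((continuous_const.mul (continuous_norm.pow 2)).mul h2)).mul (hUc.norm.pow 2)
      refine hc.integrable_of_hasCompactSupport ?_
      refine HasCompactSupport.intro (isCompact_closedBall (0 : EuclideanSpace ℝ (Fin 3)) L)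
        fun y hy => ?_
      rw [mem_closedBall_zero_iff, not_le] at hy
      have hy2 : a ≤ ‖y‖ ^ 2 := by
        rw [ha_def]
        gcongr
      simp only [show Φ (‖y‖ ^ 2) = 0 from outerCut_eq_zero ha hy2,
        show deriv Φ (‖y‖ ^ 2) = 0 from outerCut_deriv_eq_zero_of_le ha hy2]
      ring
    have hiInd : Integrable (fun y => (2 * α - 3) *
        (ball (0 : EuclideanSpace ℝ (Fin 3)) (L / 2)).indicator (fun y => ‖U y‖ ^ 2) y)
        (volume : Measure (EuclideanSpace ℝ (Fin 3))) := by
      refine Integrable.const_mul ?_ _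
      exact (((hUc.norm.pow 2).continuousOn.integrableOn_compact
        (isCompact_closedBall (0 : EuclideanSpace ℝ (Fin 3)) (L / 2))).mono_set
        ball_subset_closedBall).integrable_indicator measurableSet_ball
    have hlow : (2 * α - 3) * ∫ y in ball (0 : EuclideanSpace ℝ (Fin 3)) (L / 2), ‖U y‖ ^ 2 ≤
        ∫ y, ((2 * α - 3) * Φ (‖y‖ ^ 2) - 2 * ‖y‖ ^ 2 * deriv Φ (‖y‖ ^ 2)) * ‖U y‖ ^ 2 := by
      rw [← integral_indicator measurableSet_ball, ← integral_const_mul]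
      exact integral_mono hiInd hiL hκ
    -- upper bound of the right-hand side
    have hpt : ∀ y : EuclideanSpace ℝ (Fin 3),
        ‖(‖U y‖ ^ 2 + 2 * P y) * (2 * deriv Φ (‖y‖ ^ 2) * ⟪y, U y⟫)‖ ≤
          4 * D / L * (‖U y‖ ^ 3 + 2 * (|P y| * ‖U y‖)) := by
      intro y
      rw [Real.norm_eq_abs, abs_mul, abs_mul, abs_mul]
      have hin : |⟪y, U y⟫| ≤ ‖y‖ * ‖U y‖ := abs_real_inner_le_norm _ _
      have hA : |‖U y‖ ^ 2 + 2 * P y| ≤ ‖U y‖ ^ 2 + 2 * |P y| := by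
        calc |‖U y‖ ^ 2 + 2 * P y| ≤ |‖U y‖ ^ 2| + |2 * P y| := abs_add_le _ _
          _ = ‖U y‖ ^ 2 + 2 * |P y| := by
              rw [abs_of_nonneg (by positivity), abs_mul, abs_two]
      -- `|y| |Φ'(|y|²)| ≤ 2D/L`
      have hyd : ‖y‖ * |deriv Φ (‖y‖ ^ 2)| ≤ 2 * D / L := by
        by_cases hy : a ≤ ‖y‖ ^ 2
        · rw [show deriv Φ (‖y‖ ^ 2) = 0 from outerCut_deriv_eq_zero_of_le ha hy, abs_zero,
            mul_zero]
          positivity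
        · have hyL : ‖y‖ ≤ L := by
            by_contra hc
            exact hy (by rw [ha_def]; gcongr; linarith)
          calc ‖y‖ * |deriv Φ (‖y‖ ^ 2)| ≤ L * (2 * D / a) := by
                gcongr
                exact abs_outerCut_deriv_le ha hD _
            _ = 2 * D / L := by
                rw [ha_def]
                field_simp
      have hU0 : 0 ≤ ‖U y‖ := norm_nonneg _
      calc |‖U y‖ ^ 2 + 2 * P y| * (|2| * |deriv Φ (‖y‖ ^ 2)| * |⟪y, U y⟫|)
          ≤ (‖U y‖ ^ 2 + 2 * |P y|) * (2 * |deriv Φ (‖y‖ ^ 2)| * (‖y‖ * ‖U y‖)) := by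
            rw [abs_two]
            gcongr
        _ = (‖U y‖ ^ 2 + 2 * |P y|) * ‖U y‖ * (2 * (‖y‖ * |deriv Φ (‖y‖ ^ 2)|)) := by ring
        _ ≤ (‖U y‖ ^ 2 + 2 * |P y|) * ‖U y‖ * (2 * (2 * D / L)) := by
            gcongr
        _ = 4 * D / L * (‖U y‖ ^ 3 + 2 * (|P y| * ‖U y‖)) := by ring
    have hup : ‖∫ y, (‖U y‖ ^ 2 + 2 * P y) * (2 * deriv Φ (‖y‖ ^ 2) * ⟪y, U y⟫)‖ ≤
        4 * D / L * If := by
      rw [hIf_def, ← integral_const_mul]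
      exact norm_integral_le_of_norm_le (hflux.const_mul _) (Eventually.of_forall hpt)
    -- combine
    have hα3 : 0 < 2 * α - 3 := by linarith
    have hmain : (2 * α - 3) * ∫ y in ball (0 : EuclideanSpace ℝ (Fin 3)) (L / 2), ‖U y‖ ^ 2 ≤
        (1 + α) * (4 * D / L * If) := by
      calc (2 * α - 3) * ∫ y in ball (0 : EuclideanSpace ℝ (Fin 3)) (L / 2), ‖U y‖ ^ 2
          ≤ (1 + α) * ∫ y, (‖U y‖ ^ 2 + 2 * P y) * (2 * deriv Φ (‖y‖ ^ 2) * ⟪y, U y⟫) := by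
            rw [← key]
            exact hlow
        _ ≤ (1 + α) * ‖∫ y, (‖U y‖ ^ 2 + 2 * P y) * (2 * deriv Φ (‖y‖ ^ 2) * ⟪y, U y⟫)‖ :=
            mul_le_mul_of_nonneg_left (Real.le_norm_self _) (by linarith)
        _ ≤ (1 + α) * (4 * D / L * If) := mul_le_mul_of_nonneg_left hup (by linarith)
    rw [le_div_iff₀ hL, le_div_iff₀ hα3]
    calc (∫ y in ball (0 : EuclideanSpace ℝ (Fin 3)) (L / 2), ‖U y‖ ^ 2) * L * (2 * α - 3)
        = ((2 * α - 3) * ∫ y in ball (0 : EuclideanSpace ℝ (Fin 3)) (L / 2), ‖U y‖ ^ 2) * L := by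
          ring
      _ ≤ (1 + α) * (4 * D / L * If) * L := by gcongr
      _ = (1 + α) * (4 * D * If) := by field_simp
  -- conclude with the tree's "energy growth bound with exponent > 3/2 forces U = 0" (exponent 2)
  set C₀ : ℝ := (1 + α) * (4 * D * If) / (2 * α - 3) with hC₀_def
  refine eq_zero_of_energyGrowth_of_three_halves_lt (α := 2) (C := C₀ / 2) (L₀ := 1)
    (by norm_num) hUc fun R hR => ?_
  have hR : 0 < R := by linarith
  have hb := hball (2 * R) (by linarith)
  rw [show 2 * R / 2 = R by ring] at hb
  calc ∫ y in ball (0 : EuclideanSpace ℝ (Fin 3)) R, ‖U y‖ ^ 2 ≤ C₀ / (2 * R) := hb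
    _ = C₀ / 2 * R ^ (3 - 2 * (2 : ℝ)) := by
        rw [show (3 : ℝ) - 2 * 2 = -1 by norm_num, Real.rpow_neg_one]
        field_simp


/-! ## The inner profile `ψ_β(s) = 1 + smoothTransition (s − 1) · ((s/2)^{−β} − 1)` (range `α ≤ 1`)

`ψ_β = 1` on `s ≤ 1`, `ψ_β(s) = (s/2)^{−β}` for `s ≥ 2`, and `s^β ψ_β(s)` is nondecreasing:
`β ψ_β(s) + s ψ_β'(s) ≥ 0`. With `β = 3/2 − α > 0` and `Φ₁(t) = ψ_β(t/l₁²)` this is Chae–Shvydkoy's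
integrated family of cut-offs `∫ l^{2α−4} σ(y/l) dl` (§3.2.1) collapsed into one test function. -/

/-- `ψ_β = 1` on `s ≤ 1`. [folklore] -/
private theorem inner_eq_one {β s : ℝ} (hs : s ≤ 1) :
    1 + Real.smoothTransition (s - 1) * ((s / 2) ^ (-β) - 1) = 1 := by
  rw [Real.smoothTransition.zero_of_nonpos (by linarith), zero_mul, add_zero]

/-- Auxiliary computation. [folklore] -/
private theorem inner_eq_rpow {β s : ℝ} (hs : 2 ≤ s) :
    1 + Real.smoothTransition (s - 1) * ((s / 2) ^ (-β) - 1) = (s / 2) ^ (-β) := by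
  rw [Real.smoothTransition.one_of_one_le (by linarith), one_mul, add_sub_cancel]

/-- `ψ_β = (1 − T) + T g` with `T ∈ [0,1]`, `g > 0`: hence `ψ_β ≥ 0` (for `s > 0`). [folklore] -/
private theorem inner_nonneg {β s : ℝ} (hs : 0 < s) :
    0 ≤ 1 + Real.smoothTransition (s - 1) * ((s / 2) ^ (-β) - 1) := by
  have hT0 := Real.smoothTransition.nonneg (s - 1)
  have hT1 := Real.smoothTransition.le_one (s - 1)
  have hg : 0 < (s / 2) ^ (-β) := Real.rpow_pos_of_pos (by positivity) _
  have h1 : 0 ≤ Real.smoothTransition (s - 1) * (s / 2) ^ (-β) := mul_nonneg hT0 hg.le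
  nlinarith

/-- For `s ≥ 2` (and `β ≥ 0`), `ψ_β(s) = (s/2)^{−β} ≤ 1`. [folklore] -/
private theorem inner_le_one {β s : ℝ} (hβ : 0 ≤ β) (hs : 2 ≤ s) :
    1 + Real.smoothTransition (s - 1) * ((s / 2) ^ (-β) - 1) ≤ 1 := by
  rw [inner_eq_rpow hs]
  exact Real.rpow_le_one_of_one_le_of_nonpos (by linarith) (by linarith)

/-- The derivative of `ψ_β` at `s > 0`. [folklore] -/
private theorem inner_hasDerivAt {β s : ℝ} (hs : 0 < s) :
    HasDerivAt (fun s : ℝ => 1 + Real.smoothTransition (s - 1) * ((s / 2) ^ (-β) - 1))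
      (deriv Real.smoothTransition (s - 1) * ((s / 2) ^ (-β) - 1) +
        Real.smoothTransition (s - 1) * (1 / 2 * (-β) * (s / 2) ^ (-β - 1))) s := by
  have hT : HasDerivAt (fun s : ℝ => Real.smoothTransition (s - 1))
      (deriv Real.smoothTransition (s - 1)) s := by
    have h2 := (Calculus.differentiable_smoothTransition (s - 1)).hasDerivAt.comp s
      ((hasDerivAt_id s).sub_const 1)
    simpa [Function.comp_def] using h2
  have hg : HasDerivAt (fun s : ℝ => (s / 2) ^ (-β)) (1 / 2 * (-β) * (s / 2) ^ (-β - 1)) s := by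
    have h1 : HasDerivAt (fun s : ℝ => s / 2) (1 / 2) s := by
      simpa using (hasDerivAt_id s).div_const 2
    exact h1.rpow_const (Or.inl (by positivity))
  simpa using (hT.mul (hg.sub_const 1)).const_add 1

/-- The derivative of `ψ_β` vanishes on `s < 1` (there `ψ_β ≡ 1`). [folklore] -/
private theorem inner_hasDerivAt_zero {β s : ℝ} (hs : s < 1) :
    HasDerivAt (fun s : ℝ => 1 + Real.smoothTransition (s - 1) * ((s / 2) ^ (-β) - 1)) 0 s := by
  have hev : (fun s : ℝ => 1 + Real.smoothTransition (s - 1) * ((s / 2) ^ (-β) - 1)) =ᶠ[𝓝 s]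
      fun _ => (1 : ℝ) := by
    filter_upwards [Iio_mem_nhds hs] with r hr using inner_eq_one hr.le
  exact (hasDerivAt_const s (1 : ℝ)).congr_of_eventuallyEq hev

/-- The derivative of `ψ_β`, as a closed formula valid at every point (the formula vanishes
identically on `s ≤ 1`). [folklore] -/
private theorem inner_deriv (β s : ℝ) :
    deriv (fun s : ℝ => 1 + Real.smoothTransition (s - 1) * ((s / 2) ^ (-β) - 1)) s =
      deriv Real.smoothTransition (s - 1) * ((s / 2) ^ (-β) - 1) +
        Real.smoothTransition (s - 1) * (1 / 2 * (-β) * (s / 2) ^ (-β - 1)) := by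
  by_cases hs : 0 < s
  · exact (inner_hasDerivAt hs).deriv
  · push Not at hs
    rw [(inner_hasDerivAt_zero (by linarith : s < 1)).deriv,
      Calculus.deriv_smoothTransition_of_nonpos (by linarith),
      Real.smoothTransition.zero_of_nonpos (by linarith)]
    ring

/-- Auxiliary computation. [folklore] -/
private theorem inner_deriv_eq_zero {β s : ℝ} (hs : s ≤ 1) :
    deriv (fun s : ℝ => 1 + Real.smoothTransition (s - 1) * ((s / 2) ^ (-β) - 1)) s = 0 := by
  rw [inner_deriv, Calculus.deriv_smoothTransition_of_nonpos (by linarith),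
    Real.smoothTransition.zero_of_nonpos (by linarith)]
  ring

/-- Auxiliary computation. [folklore] -/
private theorem inner_contDiff (β : ℝ) :
    ContDiff ℝ 1 fun s : ℝ => 1 + Real.smoothTransition (s - 1) * ((s / 2) ^ (-β) - 1) := by
  refine contDiff_iff_contDiffAt.2 fun s => ?_
  by_cases hs : s < 1
  · have hev : (fun s : ℝ => 1 + Real.smoothTransition (s - 1) * ((s / 2) ^ (-β) - 1)) =ᶠ[𝓝 s]
        fun _ => (1 : ℝ) := by
      filter_upwards [Iio_mem_nhds hs] with r hr using inner_eq_one hr.le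
    exact contDiffAt_const.congr_of_eventuallyEq hev
  · push Not at hs
    have hT : ContDiffAt ℝ 1 (fun s : ℝ => Real.smoothTransition (s - 1)) s :=
      Real.smoothTransition.contDiffAt.comp s (contDiffAt_id.sub contDiffAt_const)
    have hg : ContDiffAt ℝ 1 (fun s : ℝ => (s / 2) ^ (-β)) s :=
      (contDiffAt_id.div_const 2).rpow_const_of_ne (by positivity)
    exact contDiffAt_const.add (hT.mul (hg.sub contDiffAt_const))

/-- **Monotonicity of `s^β ψ_β`**: `β ψ_β(s) + s ψ_β'(s) ≥ 0` (`β ≥ 0`). [folklore] -/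
private theorem inner_sign {β : ℝ} (hβ : 0 ≤ β) (s : ℝ) :
    0 ≤ β * (1 + Real.smoothTransition (s - 1) * ((s / 2) ^ (-β) - 1)) +
      s * deriv (fun s : ℝ => 1 + Real.smoothTransition (s - 1) * ((s / 2) ^ (-β) - 1)) s := by
  by_cases hs : s ≤ 1
  · rw [inner_eq_one hs, inner_deriv_eq_zero hs]
    nlinarith
  · push Not at hs
    have hs0 : 0 < s := by linarith
    rw [inner_deriv]
    set T := Real.smoothTransition (s - 1) with hT_def
    set T' := deriv Real.smoothTransition (s - 1) with hT'_def
    set g := (s / 2) ^ (-β) with hg_def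
    have hsg : s * (1 / 2 * (-β) * (s / 2) ^ (-β - 1)) = -β * g := by
      have hne : (s / 2 : ℝ) ≠ 0 := by positivity
      have : (s / 2) ^ (-β) = (s / 2) ^ (-β - 1) * (s / 2) := by
        rw [← Real.rpow_add_one hne]
        ring_nf
      rw [hg_def, this]
      ring
    have hT1 : T ≤ 1 := Real.smoothTransition.le_one _
    have hT'0 : 0 ≤ T' := Real.smoothTransition.monotone.deriv_nonneg
    -- the identity `βψ + sψ' = β(1 − T) + s T'(g − 1)`
    have hid : β * (1 + T * (g - 1)) + s * (T' * (g - 1) + T * (1 / 2 * (-β) * (s / 2) ^ (-β - 1))) =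
        β * (1 - T) + s * T' * (g - 1) := by
      have : s * (T * (1 / 2 * (-β) * (s / 2) ^ (-β - 1))) = T * (-β * g) := by
        rw [← hsg]
        ring
      linear_combination this
    rw [hid]
    have h1 : 0 ≤ β * (1 - T) := mul_nonneg hβ (by linarith)
    have h2 : 0 ≤ s * T' * (g - 1) := by
      by_cases hs2 : s ≤ 2
      · have hg1 : 1 ≤ g :=
          Real.one_le_rpow_of_pos_of_le_one_of_nonpos (by positivity) (by linarith) (by linarith)
        have : 0 ≤ s * T' := mul_nonneg hs0.le hT'0
        nlinarith
      · push Not at hs2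
        rw [hT'_def, Calculus.deriv_smoothTransition_of_one_le (by linarith)]
        simp
    linarith

/-- **Decay of `ψ_β'`**: `s |ψ_β'(s)| ≤ (D + β) 2^{β+1}` for `s ≥ 1`, where `|σ'| ≤ D`. [folklore] -/
private theorem inner_abs_deriv_mul_le {β : ℝ} (hβ : 0 ≤ β) {D : ℝ} (hD0 : 0 ≤ D)
    (hD : ∀ r, |deriv Real.smoothTransition r| ≤ D) {s : ℝ} (hs : 1 ≤ s) :
    |deriv (fun s : ℝ => 1 + Real.smoothTransition (s - 1) * ((s / 2) ^ (-β) - 1)) s| * s ≤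
      (D + β) * (2 : ℝ) ^ (β + 1) := by
  have hs0 : 0 < s := by linarith
  rw [inner_deriv]
  set T := Real.smoothTransition (s - 1) with hT_def
  set T' := deriv Real.smoothTransition (s - 1) with hT'_def
  set g := (s / 2) ^ (-β) with hg_def
  have hne : (s / 2 : ℝ) ≠ 0 := by positivity
  have h2β : (2 : ℝ) ^ (β + 1) = 2 ^ β * 2 := Real.rpow_add_one two_ne_zero β
  have h2β0 : 0 < (2 : ℝ) ^ β := Real.rpow_pos_of_pos two_pos _
  have hg0 : 0 < g := Real.rpow_pos_of_pos (by positivity) _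
  -- `g ≤ 2^β` (as `s/2 ≥ 1/2`)
  have hgle : g ≤ (2 : ℝ) ^ β := by
    have h1 : g ≤ (1 / 2 : ℝ) ^ (-β) :=
      Real.rpow_le_rpow_of_nonpos (by norm_num) (by linarith) (by linarith)
    have h2 : (1 / 2 : ℝ) ^ (-β) = 2 ^ β := by
      rw [one_div, Real.inv_rpow (by norm_num), Real.rpow_neg (by norm_num), inv_inv]
    linarith [h2 ▸ h1]
  -- second term: `s · |T| · (β/2) (s/2)^{−β−1} = β T g ≤ β 2^β`
  have hsg : s * (1 / 2 * (-β) * (s / 2) ^ (-β - 1)) = -β * g := by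
    have : (s / 2) ^ (-β) = (s / 2) ^ (-β - 1) * (s / 2) := by
      rw [← Real.rpow_add_one hne]
      ring_nf
    rw [hg_def, this]
    ring
  have hT0 : 0 ≤ T := Real.smoothTransition.nonneg _
  have hT1 : T ≤ 1 := Real.smoothTransition.le_one _
  have hT'0 : 0 ≤ T' := Real.smoothTransition.monotone.deriv_nonneg
  have hB : |T * (1 / 2 * (-β) * (s / 2) ^ (-β - 1))| * s ≤ β * 2 ^ β := by
    have : |T * (1 / 2 * (-β) * (s / 2) ^ (-β - 1))| * s = β * T * g := by
      rw [abs_mul, abs_of_nonneg hT0]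
      have hin : 1 / 2 * (-β) * (s / 2) ^ (-β - 1) ≤ 0 := by
        have : 0 < (s / 2) ^ (-β - 1) := Real.rpow_pos_of_pos (by positivity) _
        nlinarith
      rw [abs_of_nonpos hin]
      linear_combination (-T) * hsg
    rw [this]
    have : T * g ≤ 1 * 2 ^ β := by gcongr
    nlinarith
  -- first term: `s |T'| |g − 1| ≤ D 2^{β+1}` (vanishes for `s > 2`)
  have hA : |T' * (g - 1)| * s ≤ D * (2 ^ β * 2) := by
    by_cases hs2 : s ≤ 2
    · have hg1 : 1 ≤ g :=
        Real.one_le_rpow_of_pos_of_le_one_of_nonpos (by positivity) (by linarith) (by linarith)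
      rw [abs_mul, abs_of_nonneg (by linarith : 0 ≤ g - 1)]
      calc |T'| * (g - 1) * s ≤ D * 2 ^ β * 2 := by
            gcongr
            · exact hD _
            · linarith
        _ = D * (2 ^ β * 2) := by ring
    · push Not at hs2
      rw [hT'_def, Calculus.deriv_smoothTransition_of_one_le (by linarith), zero_mul, abs_zero,
        zero_mul]
      positivity
  calc |T' * (g - 1) + T * (1 / 2 * (-β) * (s / 2) ^ (-β - 1))| * s
      ≤ (|T' * (g - 1)| + |T * (1 / 2 * (-β) * (s / 2) ^ (-β - 1))|) * s := by
        gcongr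
        exact abs_add_le _ _
    _ = |T' * (g - 1)| * s + |T * (1 / 2 * (-β) * (s / 2) ^ (-β - 1))| * s := by ring
    _ ≤ D * (2 ^ β * 2) + β * 2 ^ β := add_le_add hA hB
    _ ≤ (D + β) * (2 : ℝ) ^ (β + 1) := by
        rw [h2β]
        nlinarith

/-! ## Theorem 3.2 at `p = 3` in the range `−1 < α ≤ 1` -/

/-- **The inner cut-off, packaged.** For `β ≥ 0`, `a > 0` and `|σ'| ≤ D`: the `C¹` function
`Φ₁(t) = ψ_β(t/a)` is `1` on `t ≤ a`, equals `(t/(2a))^{−β} ≤ 1` on `t ≥ 2a`, is `≥ 0` on `t > 0`,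
`t ↦ t^β Φ₁(t)` is nondecreasing (`−2βΦ₁ − 2tΦ₁' ≤ 0`), and `t |Φ₁'(t)| ≤ (D+β)2^{β+1}` for
`t ≥ a`. [folklore] -/
private theorem exists_innerCut {β a D : ℝ} (hβ : 0 ≤ β) (ha : 0 < a) (hD0 : 0 ≤ D)
    (hD : ∀ r, |deriv Real.smoothTransition r| ≤ D) :
    ∃ Φ₁ : ℝ → ℝ, ContDiff ℝ 1 Φ₁ ∧ (∀ t, t ≤ a → Φ₁ t = 1) ∧ (∀ t, t ≤ a → deriv Φ₁ t = 0) ∧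
      (∀ t, 0 < t → 0 ≤ Φ₁ t) ∧ (∀ t, 2 * a ≤ t → Φ₁ t ≤ 1) ∧
      (∀ t, 2 * a ≤ t → Φ₁ t = (t / a / 2) ^ (-β)) ∧
      (∀ t, -(2 * β) * Φ₁ t - 2 * t * deriv Φ₁ t ≤ 0) ∧
      (∀ t, a ≤ t → |deriv Φ₁ t| * t ≤ (D + β) * (2 : ℝ) ^ (β + 1)) := by
  set ψ : ℝ → ℝ := fun s => 1 + Real.smoothTransition (s - 1) * ((s / 2) ^ (-β) - 1) with hψ
  have hψ1 : ContDiff ℝ 1 ψ := inner_contDiff β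
  have hd : ∀ t, HasDerivAt (fun t => ψ (t / a)) (deriv ψ (t / a) * (1 / a)) t := fun t =>
    ((hψ1.differentiable one_ne_zero) _).hasDerivAt.comp t
      (by simpa using (hasDerivAt_id t).div_const a)
  refine ⟨fun t => ψ (t / a), hψ1.comp (contDiff_id.div_const a), ?_, ?_, ?_, ?_, ?_, ?_, ?_⟩
  · intro t ht
    exact inner_eq_one (by rwa [div_le_one ha])
  · intro t ht
    rw [(hd t).deriv, show deriv ψ (t / a) = 0 from inner_deriv_eq_zero (by rwa [div_le_one ha]),
      zero_mul]
  · intro t ht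
    exact inner_nonneg (by positivity)
  · intro t ht
    exact inner_le_one hβ (by rw [le_div_iff₀ ha]; linarith)
  · intro t ht
    exact inner_eq_rpow (by rw [le_div_iff₀ ha]; linarith)
  · intro t
    rw [(hd t).deriv]
    have hs := inner_sign hβ (t / a)
    have : -(2 * β) * ψ (t / a) - 2 * t * (deriv ψ (t / a) * (1 / a)) =
        -2 * (β * ψ (t / a) + t / a * deriv ψ (t / a)) := by
      field_simp
      ring
    rw [this]
    linarith
  · intro t ht
    rw [(hd t).deriv, abs_mul, abs_of_pos (by positivity : (0 : ℝ) < 1 / a)]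
    have hbd := inner_abs_deriv_mul_le hβ hD0 hD (s := t / a) (by rwa [le_div_iff₀ ha, one_mul])
    calc |deriv ψ (t / a)| * (1 / a) * t = |deriv ψ (t / a)| * (t / a) := by
          field_simp
      _ ≤ (D + β) * (2 : ℝ) ^ (β + 1) := hbd

/-- **The outer cut-off, packaged.** For `b > 0` and `|σ'| ≤ D`: the smooth function
`Φ₂(t) = σ(2 − 2t/b)` is `1` on `t ≤ b/2`, `0` on `t ≥ b`, takes values in `[0,1]`, is
nonincreasing, and `|Φ₂'| ≤ 2D/b` (with `Φ₂' = 0` off `(b/2, b)`). [folklore] -/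
private theorem exists_outerCut {b D : ℝ} (hb : 0 < b)
    (hD : ∀ r, |deriv Real.smoothTransition r| ≤ D) :
    ∃ Φ₂ : ℝ → ℝ, ContDiff ℝ 1 Φ₂ ∧ (∀ t, t ≤ b / 2 → Φ₂ t = 1) ∧ (∀ t, b ≤ t → Φ₂ t = 0) ∧
      (∀ t, 0 ≤ Φ₂ t) ∧ (∀ t, Φ₂ t ≤ 1) ∧ (∀ t, deriv Φ₂ t ≤ 0) ∧
      (∀ t, |deriv Φ₂ t| ≤ 2 * D / b) ∧ (∀ t, t ≤ b / 2 → deriv Φ₂ t = 0) ∧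
      (∀ t, b ≤ t → deriv Φ₂ t = 0) :=
  ⟨fun t => Real.smoothTransition (2 - 2 / b * t), outerCut_contDiff b,
    fun _ ht => outerCut_eq_one hb ht, fun _ ht => outerCut_eq_zero hb ht, outerCut_nonneg b,
    outerCut_le_one b, outerCut_deriv_nonpos hb, abs_outerCut_deriv_le hb hD,
    fun _ ht => outerCut_deriv_eq_zero_of_le_half hb ht,
    fun _ ht => outerCut_deriv_eq_zero_of_le hb ht⟩

/-- `(l₂²/l₁²/4)^{−1/2} = 2 l₁/l₂`. [folklore] -/
private theorem rpow_ratio_eq {l₁ l₂ : ℝ} (hl₁ : 0 < l₁) (hl₂ : 0 < l₂) :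
    (l₂ ^ 2 / l₁ ^ 2 / 4) ^ (-(1 / 2 : ℝ)) = 2 * l₁ / l₂ := by
  rw [show l₂ ^ 2 / l₁ ^ 2 / 4 = (l₂ / (2 * l₁)) ^ 2 by field_simp; ring, ← Real.rpow_natCast,
    ← Real.rpow_mul (by positivity)]
  norm_num
  rw [Real.rpow_neg_one]
  field_simp

/-- The `L³` tail `∫_{|y|² ≥ r} |U|³ → 0` as `r → ∞`. [folklore] -/
private theorem tendsto_tail_integral_norm_cube
    {U : EuclideanSpace ℝ (Fin 3) → EuclideanSpace ℝ (Fin 3)} (hU3 : MemLp U 3 volume) :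
    Tendsto (fun r : ℝ => ∫ y in {y : EuclideanSpace ℝ (Fin 3) | r ≤ ‖y‖ ^ 2}, ‖U y‖ ^ (3 : ℝ))
      atTop (𝓝 0) := by
  have hint : Integrable (fun y => ‖U y‖ ^ (3 : ℝ)) (volume : Measure (EuclideanSpace ℝ (Fin 3))) := by
    simpa using hU3.integrable_norm_rpow (by norm_num) (by norm_num)
  have hmeas : ∀ r : ℝ, MeasurableSet {y : EuclideanSpace ℝ (Fin 3) | r ≤ ‖y‖ ^ 2} := fun r =>
    (isClosed_le continuous_const (continuous_norm.pow 2)).measurableSet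
  have hanti : Antitone fun r : ℝ => {y : EuclideanSpace ℝ (Fin 3) | r ≤ ‖y‖ ^ 2} :=
    fun r₁ r₂ h y (hy : r₂ ≤ ‖y‖ ^ 2) => le_trans h hy
  have h := tendsto_setIntegral_of_antitone (μ := volume) (f := fun y => ‖U y‖ ^ (3 : ℝ))
    hmeas hanti ⟨0, hint.integrableOn⟩
  have hempty : (⋂ r : ℝ, {y : EuclideanSpace ℝ (Fin 3) | r ≤ ‖y‖ ^ 2}) = ∅ := by
    ext y
    simp only [mem_iInter, mem_setOf_eq, mem_empty_iff_false, iff_false, not_forall, not_le]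
    exact ⟨‖y‖ ^ 2 + 1, by linarith⟩
  rwa [hempty, Measure.restrict_empty, integral_zero_measure] at h

/-- **(P1) The left integrand, pointwise.** With `Φ = Φ₁Φ₂`:
`κ(t)|U|² ≤ −(3−2α) 1_{|y|<l₁} |U|² + 2tΦ₁(t)(−Φ₂'(t))|U|²`, `t = |y|²`. [folklore] -/
private theorem twoScale_P1 {α a b l₁ : ℝ} {Φ₁ Φ₂ : ℝ → ℝ}
    (U : EuclideanSpace ℝ (Fin 3) → EuclideanSpace ℝ (Fin 3)) (ha : a = l₁ ^ 2) (hab : a ≤ b / 2)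
    (hΦ₁one : ∀ t, t ≤ a → Φ₁ t = 1) (hΦ₁d0 : ∀ t, t ≤ a → deriv Φ₁ t = 0)
    (hΦ₁sign : ∀ t, (2 * α - 3) * Φ₁ t - 2 * t * deriv Φ₁ t ≤ 0)
    (hΦ₂one : ∀ t, t ≤ b / 2 → Φ₂ t = 1) (hΦ₂nn : ∀ t, 0 ≤ Φ₂ t)
    (hΦd : ∀ t, deriv (fun t => Φ₁ t * Φ₂ t) t = deriv Φ₁ t * Φ₂ t + Φ₁ t * deriv Φ₂ t)
    (y : EuclideanSpace ℝ (Fin 3)) :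
    ((2 * α - 3) * (Φ₁ (‖y‖ ^ 2) * Φ₂ (‖y‖ ^ 2)) -
        2 * ‖y‖ ^ 2 * deriv (fun t => Φ₁ t * Φ₂ t) (‖y‖ ^ 2)) * ‖U y‖ ^ 2 ≤
      -(3 - 2 * α) * (ball (0 : EuclideanSpace ℝ (Fin 3)) l₁).indicator (fun y => ‖U y‖ ^ 2) y +
        2 * ‖y‖ ^ 2 * Φ₁ (‖y‖ ^ 2) * (-deriv Φ₂ (‖y‖ ^ 2)) * ‖U y‖ ^ 2 := by
  have hκ₁ := hΦ₁sign (‖y‖ ^ 2)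
  have hdecomp : ((2 * α - 3) * (Φ₁ (‖y‖ ^ 2) * Φ₂ (‖y‖ ^ 2)) -
      2 * ‖y‖ ^ 2 * deriv (fun t => Φ₁ t * Φ₂ t) (‖y‖ ^ 2)) * ‖U y‖ ^ 2 =
      ((2 * α - 3) * Φ₁ (‖y‖ ^ 2) - 2 * ‖y‖ ^ 2 * deriv Φ₁ (‖y‖ ^ 2)) * Φ₂ (‖y‖ ^ 2) *
        ‖U y‖ ^ 2 + 2 * ‖y‖ ^ 2 * Φ₁ (‖y‖ ^ 2) * (-deriv Φ₂ (‖y‖ ^ 2)) * ‖U y‖ ^ 2 := by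
    rw [hΦd]
    ring
  rw [hdecomp]
  gcongr ?_ + _
  by_cases hy : y ∈ ball (0 : EuclideanSpace ℝ (Fin 3)) l₁
  · rw [indicator_of_mem hy]
    have hta : ‖y‖ ^ 2 ≤ a := by
      rw [mem_ball_zero_iff] at hy
      rw [ha]
      exact pow_le_pow_left₀ (norm_nonneg _) hy.le 2
    have htb : ‖y‖ ^ 2 ≤ b / 2 := by linarith
    rw [hΦ₁one _ hta, hΦ₁d0 _ hta, hΦ₂one _ htb]
    nlinarith [sq_nonneg ‖U y‖]
  · rw [indicator_of_notMem hy, mul_zero]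
    have : 0 ≤ -((2 * α - 3) * Φ₁ (‖y‖ ^ 2) - 2 * ‖y‖ ^ 2 * deriv Φ₁ (‖y‖ ^ 2)) *
        Φ₂ (‖y‖ ^ 2) := mul_nonneg (by linarith) (hΦ₂nn _)
    nlinarith [sq_nonneg ‖U y‖]

/-- **(P3) The annular weight, pointwise.** On `b/2 < |y|² < b` one has
`Φ₁(|y|²) = (|y|²/(2a))^{−β} ≤ (b/(4a))^{−1/2} = 2l₁/l₂` (`β ≥ 1/2` — here `α ≤ 1` enters) and
`|Φ₂'| ≤ 2D/b`, so `2tΦ₁(−Φ₂')|U|² ≤ (8Dl₁/l₂) 1_S |U|²`, `S = {b/2 ≤ |y|²} ∩ {|y| ≤ l₂}`. [folklore] -/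
private theorem twoScale_P3 {β a b D l₁ l₂ : ℝ} {Φ₁ Φ₂ : ℝ → ℝ}
    (U : EuclideanSpace ℝ (Fin 3) → EuclideanSpace ℝ (Fin 3)) (hl₁ : 0 < l₁) (hl₂ : 0 < l₂)
    (ha : a = l₁ ^ 2) (hb : b = l₂ ^ 2) (hab : 4 * a ≤ b) (hβ : 1 / 2 ≤ β) (hD0 : 0 ≤ D)
    (hΦ₁nn : ∀ t, 0 < t → 0 ≤ Φ₁ t) (hΦ₁two : ∀ t, 2 * a ≤ t → Φ₁ t = (t / a / 2) ^ (-β))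
    (hΦ₂d0 : ∀ t, deriv Φ₂ t ≤ 0) (hΦ₂dle : ∀ t, |deriv Φ₂ t| ≤ 2 * D / b)
    (hΦ₂d_half : ∀ t, t ≤ b / 2 → deriv Φ₂ t = 0) (hΦ₂d_b : ∀ t, b ≤ t → deriv Φ₂ t = 0)
    (y : EuclideanSpace ℝ (Fin 3)) :
    2 * ‖y‖ ^ 2 * Φ₁ (‖y‖ ^ 2) * (-deriv Φ₂ (‖y‖ ^ 2)) * ‖U y‖ ^ 2 ≤
      8 * D * l₁ / l₂ * ({y : EuclideanSpace ℝ (Fin 3) | b / 2 ≤ ‖y‖ ^ 2} ∩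
        closedBall (0 : EuclideanSpace ℝ (Fin 3)) l₂).indicator (fun y => ‖U y‖ ^ 2) y := by
  have ha0 : 0 < a := by rw [ha]; positivity
  have hind0 : 0 ≤ 8 * D * l₁ / l₂ * ({y : EuclideanSpace ℝ (Fin 3) | b / 2 ≤ ‖y‖ ^ 2} ∩
      closedBall (0 : EuclideanSpace ℝ (Fin 3)) l₂).indicator (fun y => ‖U y‖ ^ 2) y := by
    have : 0 ≤ ({y : EuclideanSpace ℝ (Fin 3) | b / 2 ≤ ‖y‖ ^ 2} ∩
        closedBall (0 : EuclideanSpace ℝ (Fin 3)) l₂).indicator (fun y => ‖U y‖ ^ 2) y :=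
      indicator_nonneg (fun _ _ => by positivity) _
    positivity
  by_cases h1 : ‖y‖ ^ 2 ≤ b / 2
  · rw [hΦ₂d_half _ h1, neg_zero, mul_zero, zero_mul]
    exact hind0
  by_cases h2 : b ≤ ‖y‖ ^ 2
  · rw [hΦ₂d_b _ h2, neg_zero, mul_zero, zero_mul]
    exact hind0
  push Not at h1 h2
  have hyS : y ∈ {y : EuclideanSpace ℝ (Fin 3) | b / 2 ≤ ‖y‖ ^ 2} ∩
      closedBall (0 : EuclideanSpace ℝ (Fin 3)) l₂ := by
    refine ⟨h1.le, ?_⟩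
    rw [mem_closedBall_zero_iff]
    rw [hb] at h2
    exact le_of_lt (lt_of_pow_lt_pow_left₀ 2 hl₂.le h2)
  rw [indicator_of_mem hyS]
  have h2a : 2 * a ≤ ‖y‖ ^ 2 := by linarith
  have hbase : 1 ≤ ‖y‖ ^ 2 / a / 2 := by
    rw [le_div_iff₀ two_pos, le_div_iff₀ ha0]
    linarith
  have hΦ₁bd : Φ₁ (‖y‖ ^ 2) ≤ 2 * l₁ / l₂ := by
    rw [hΦ₁two _ h2a]
    calc (‖y‖ ^ 2 / a / 2) ^ (-β) ≤ (‖y‖ ^ 2 / a / 2) ^ (-(1 / 2 : ℝ)) :=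
          Real.rpow_le_rpow_of_exponent_le hbase (by linarith)
      _ ≤ (b / a / 4) ^ (-(1 / 2 : ℝ)) := by
          refine Real.rpow_le_rpow_of_nonpos (by rw [hb]; positivity) ?_ (by norm_num)
          have hnum : b / 4 ≤ ‖y‖ ^ 2 / 2 := by linarith
          calc b / a / 4 = (b / 4) / a := by ring
            _ ≤ (‖y‖ ^ 2 / 2) / a := div_le_div_of_nonneg_right hnum ha0.le
            _ = ‖y‖ ^ 2 / a / 2 := by ring
      _ = 2 * l₁ / l₂ := by
          rw [hb, ha]
          exact rpow_ratio_eq hl₁ hl₂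
  have hd : -deriv Φ₂ (‖y‖ ^ 2) ≤ 2 * D / b := by
    have := hΦ₂dle (‖y‖ ^ 2)
    rw [abs_le] at this
    linarith
  have hd0 : 0 ≤ -deriv Φ₂ (‖y‖ ^ 2) := by linarith [hΦ₂d0 (‖y‖ ^ 2)]
  have hΦ₁0 : 0 ≤ Φ₁ (‖y‖ ^ 2) := hΦ₁nn _ (by linarith)
  have hb0 : 0 < b := by rw [hb]; positivity
  have step : 2 * ‖y‖ ^ 2 * Φ₁ (‖y‖ ^ 2) * (-deriv Φ₂ (‖y‖ ^ 2)) ≤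
      2 * b * (2 * l₁ / l₂) * (2 * D / b) := by
    have e1 : 2 * ‖y‖ ^ 2 ≤ 2 * b := by linarith
    exact mul_le_mul (mul_le_mul e1 hΦ₁bd hΦ₁0 (by positivity)) hd hd0 (by positivity)
  calc 2 * ‖y‖ ^ 2 * Φ₁ (‖y‖ ^ 2) * (-deriv Φ₂ (‖y‖ ^ 2)) * ‖U y‖ ^ 2
      ≤ 2 * b * (2 * l₁ / l₂) * (2 * D / b) * ‖U y‖ ^ 2 :=
        mul_le_mul_of_nonneg_right step (sq_nonneg _)
    _ = 8 * D * l₁ / l₂ * ‖U y‖ ^ 2 := by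
        field_simp
        ring

/-- **(P2) The flux integrand, pointwise.** `|Φ'(|y|²)| |y| ≤ (K₂ + 2D)/l₁` where `Φ = Φ₁Φ₂`
(`t|Φ₁'| ≤ K₂` on `t ≥ a`, `Φ₁' = 0` on `t ≤ a`; `Φ₁|Φ₂'| |y| ≤ (2D/b) l₂` on `(b/2, b)`), hence
`|(|U|²+2P)(2Φ'⟪y,U⟫)| ≤ (2K₂+4D)/l₁ (|U|³ + 2|P||U|)`. [folklore] -/
private theorem twoScale_P2 {a b D K₂ l₁ l₂ : ℝ} {Φ₁ Φ₂ : ℝ → ℝ}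
    (U : EuclideanSpace ℝ (Fin 3) → EuclideanSpace ℝ (Fin 3)) (P : EuclideanSpace ℝ (Fin 3) → ℝ)
    (hl₁ : 0 < l₁) (hl₁₂ : l₁ ≤ l₂) (ha : a = l₁ ^ 2) (hb : b = l₂ ^ 2) (hab : 4 * a ≤ b)
    (hD0 : 0 ≤ D) (hK₂ : 0 ≤ K₂)
    (hΦ₁d0 : ∀ t, t ≤ a → deriv Φ₁ t = 0) (hΦ₁dec : ∀ t, a ≤ t → |deriv Φ₁ t| * t ≤ K₂)
    (hΦ₁nn : ∀ t, 0 < t → 0 ≤ Φ₁ t) (hΦ₁le : ∀ t, 2 * a ≤ t → Φ₁ t ≤ 1)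
    (hΦ₂nn : ∀ t, 0 ≤ Φ₂ t) (hΦ₂le : ∀ t, Φ₂ t ≤ 1) (hΦ₂dle : ∀ t, |deriv Φ₂ t| ≤ 2 * D / b)
    (hΦ₂d_half : ∀ t, t ≤ b / 2 → deriv Φ₂ t = 0) (hΦ₂d_b : ∀ t, b ≤ t → deriv Φ₂ t = 0)
    (hΦd : ∀ t, deriv (fun t => Φ₁ t * Φ₂ t) t = deriv Φ₁ t * Φ₂ t + Φ₁ t * deriv Φ₂ t)
    (y : EuclideanSpace ℝ (Fin 3)) :
    ‖(‖U y‖ ^ 2 + 2 * P y) * (2 * deriv (fun t => Φ₁ t * Φ₂ t) (‖y‖ ^ 2) * ⟪y, U y⟫)‖ ≤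
      (2 * K₂ + 4 * D) / l₁ * (‖U y‖ ^ 3 + 2 * (|P y| * ‖U y‖)) := by
  have hl₂ : 0 < l₂ := lt_of_lt_of_le hl₁ hl₁₂
  have ha0 : 0 < a := by rw [ha]; positivity
  have hb0 : 0 < b := by rw [hb]; positivity
  -- inner part: `|Φ₁'(t) Φ₂(t)| |y| ≤ K₂/l₁`
  have hT1 : |deriv Φ₁ (‖y‖ ^ 2) * Φ₂ (‖y‖ ^ 2)| * ‖y‖ ≤ K₂ / l₁ := by
    by_cases hta : ‖y‖ ^ 2 ≤ a
    · rw [hΦ₁d0 _ hta, zero_mul, abs_zero, zero_mul]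
      positivity
    · push Not at hta
      have hyl : l₁ ≤ ‖y‖ := by
        rw [ha] at hta
        exact le_of_lt (lt_of_pow_lt_pow_left₀ 2 (norm_nonneg _) hta)
      have hy0 : 0 < ‖y‖ := lt_of_lt_of_le hl₁ hyl
      have hbd := hΦ₁dec (‖y‖ ^ 2) hta.le
      calc |deriv Φ₁ (‖y‖ ^ 2) * Φ₂ (‖y‖ ^ 2)| * ‖y‖
          ≤ |deriv Φ₁ (‖y‖ ^ 2)| * 1 * ‖y‖ := by
            rw [abs_mul]
            gcongr
            rw [abs_of_nonneg (hΦ₂nn _)]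
            exact hΦ₂le _
        _ = |deriv Φ₁ (‖y‖ ^ 2)| * ‖y‖ ^ 2 / ‖y‖ := by
            field_simp
        _ ≤ K₂ / ‖y‖ := by
            gcongr
        _ ≤ K₂ / l₁ := by
            gcongr
  -- outer part: `Φ₁(t) |Φ₂'(t)| |y| ≤ 2D/l₁`
  have hT2 : |Φ₁ (‖y‖ ^ 2) * deriv Φ₂ (‖y‖ ^ 2)| * ‖y‖ ≤ 2 * D / l₁ := by
    by_cases h1 : ‖y‖ ^ 2 ≤ b / 2
    · rw [hΦ₂d_half _ h1, mul_zero, abs_zero, zero_mul]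
      positivity
    by_cases h2 : b ≤ ‖y‖ ^ 2
    · rw [hΦ₂d_b _ h2, mul_zero, abs_zero, zero_mul]
      positivity
    push Not at h1 h2
    have h2a : 2 * a ≤ ‖y‖ ^ 2 := by linarith
    have hyl : ‖y‖ ≤ l₂ := by
      rw [hb] at h2
      exact le_of_lt (lt_of_pow_lt_pow_left₀ 2 hl₂.le h2)
    rw [abs_mul, abs_of_nonneg (hΦ₁nn _ (by linarith))]
    calc Φ₁ (‖y‖ ^ 2) * |deriv Φ₂ (‖y‖ ^ 2)| * ‖y‖ ≤ 1 * (2 * D / b) * l₂ := by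
          gcongr
          · exact hΦ₁le _ h2a
          · exact hΦ₂dle _
      _ = 2 * D / l₂ := by rw [hb]; field_simp
      _ ≤ 2 * D / l₁ := by gcongr
  have hDφ : |deriv (fun t => Φ₁ t * Φ₂ t) (‖y‖ ^ 2)| * ‖y‖ ≤ (K₂ + 2 * D) / l₁ := by
    rw [hΦd]
    calc |deriv Φ₁ (‖y‖ ^ 2) * Φ₂ (‖y‖ ^ 2) + Φ₁ (‖y‖ ^ 2) * deriv Φ₂ (‖y‖ ^ 2)| * ‖y‖
        ≤ (|deriv Φ₁ (‖y‖ ^ 2) * Φ₂ (‖y‖ ^ 2)| + |Φ₁ (‖y‖ ^ 2) * deriv Φ₂ (‖y‖ ^ 2)|) *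
            ‖y‖ := by
          gcongr
          exact abs_add_le _ _
      _ ≤ K₂ / l₁ + 2 * D / l₁ := by
          rw [add_mul]
          exact add_le_add hT1 hT2
      _ = (K₂ + 2 * D) / l₁ := by ring
  rw [Real.norm_eq_abs, abs_mul, abs_mul, abs_mul]
  have hin : |⟪y, U y⟫| ≤ ‖y‖ * ‖U y‖ := abs_real_inner_le_norm _ _
  have hA : |‖U y‖ ^ 2 + 2 * P y| ≤ ‖U y‖ ^ 2 + 2 * |P y| := by
    calc |‖U y‖ ^ 2 + 2 * P y| ≤ |‖U y‖ ^ 2| + |2 * P y| := abs_add_le _ _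
      _ = ‖U y‖ ^ 2 + 2 * |P y| := by
          rw [abs_of_nonneg (by positivity), abs_mul, abs_two]
  calc |‖U y‖ ^ 2 + 2 * P y| * (|2| * |deriv (fun t => Φ₁ t * Φ₂ t) (‖y‖ ^ 2)| * |⟪y, U y⟫|)
      ≤ (‖U y‖ ^ 2 + 2 * |P y|) *
          (2 * |deriv (fun t => Φ₁ t * Φ₂ t) (‖y‖ ^ 2)| * (‖y‖ * ‖U y‖)) := by
        rw [abs_two]
        gcongr
    _ = (‖U y‖ ^ 2 + 2 * |P y|) * ‖U y‖ *
          (2 * (|deriv (fun t => Φ₁ t * Φ₂ t) (‖y‖ ^ 2)| * ‖y‖)) := by ring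
    _ ≤ (‖U y‖ ^ 2 + 2 * |P y|) * ‖U y‖ * (2 * ((K₂ + 2 * D) / l₁)) := by gcongr
    _ = (2 * K₂ + 4 * D) / l₁ * (‖U y‖ ^ 3 + 2 * (|P y| * ‖U y‖)) := by ring

/-- **The two-scale inequality** (CS13 (3.2) at `p = 3`, in closed form). For `−1 < α ≤ 1`,
`U ∈ L³`, `P ∈ L^{3/2}` and scales `0 < l₁`, `max(2l₁, 1) ≤ l₂`:
`(3−2α) ∫_{|y|<l₁} |U|² ≤ 8 D l₁ v₁^{1/3} (∫_{|y|² ≥ l₂²/2} |U|³)^{2/3} + (1+α)(2K₂+4D)/l₁ ∫(|U|³+2|P||U|)`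
(`v₁` the volume of the unit ball, `K₂ = (D + β)2^{β+1}`, `β = 3/2 − α`, `|σ'| ≤ D`).
[cite: ChaeShvydkoy2013, §3.2.1 eq. (3.2)] -/
theorem IsSelfSimilarEulerProfile.twoScale_ineq {α : ℝ}
    {U : EuclideanSpace ℝ (Fin 3) → EuclideanSpace ℝ (Fin 3)} {P : EuclideanSpace ℝ (Fin 3) → ℝ}
    (h : IsSelfSimilarEulerProfile (1 / (α + 1)) 0 U P) (hα : -1 < α) (hα1 : α ≤ 1)
    (hU3 : MemLp U 3 volume) (hP : MemLp P (3 / 2 : ℝ≥0∞) volume) {D : ℝ} (hD0 : 0 ≤ D)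
    (hD : ∀ r, |deriv Real.smoothTransition r| ≤ D) {l₁ l₂ : ℝ} (hl₁ : 0 < l₁)
    (hl₂ : max (2 * l₁) 1 ≤ l₂) :
    (3 - 2 * α) * ∫ y in ball (0 : EuclideanSpace ℝ (Fin 3)) l₁, ‖U y‖ ^ 2 ≤
      8 * D * l₁ * ((volume : Measure (EuclideanSpace ℝ (Fin 3))).real
          (closedBall (0 : EuclideanSpace ℝ (Fin 3)) 1)) ^ (1 / 3 : ℝ) *
        (∫ y in {y : EuclideanSpace ℝ (Fin 3) | l₂ ^ 2 / 2 ≤ ‖y‖ ^ 2}, ‖U y‖ ^ (3 : ℝ)) ^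
          (1 / (3 / 2) : ℝ) +
      (1 + α) * ((2 * ((D + (3 / 2 - α)) * (2 : ℝ) ^ ((3 / 2 - α) + 1)) + 4 * D) / l₁ *
        ∫ y, (‖U y‖ ^ 3 + 2 * (|P y| * ‖U y‖))) := by
  have hα0 : α + 1 ≠ 0 := by
    intro h0
    linarith
  have hUc : Continuous U := h.contDiff_velocity.continuous
  have hβ0 : (0 : ℝ) ≤ 3 / 2 - α := by linarith
  have hK₂ : 0 ≤ (D + (3 / 2 - α)) * (2 : ℝ) ^ ((3 / 2 - α) + 1) := by positivity
  have hflux := integrable_flux hU3 hP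
  have hv₁ : 0 ≤ (volume : Measure (EuclideanSpace ℝ (Fin 3))).real
      (closedBall (0 : EuclideanSpace ℝ (Fin 3)) 1) := measureReal_nonneg
  have hint3 : Integrable (fun y => ‖U y‖ ^ (3 : ℝ)) (volume : Measure (EuclideanSpace ℝ (Fin 3))) := by
    simpa using hU3.integrable_norm_rpow (by norm_num) (by norm_num)
  have hl₂1 : 1 ≤ l₂ := le_trans (le_max_right _ _) hl₂
  have hl₂2 : 2 * l₁ ≤ l₂ := le_trans (le_max_left _ _) hl₂
  have hl₂0 : 0 < l₂ := by linarith
  have hl₁₂ : l₁ ≤ l₂ := by linarith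
  have ha : (0 : ℝ) < l₁ ^ 2 := by positivity
  have hb : (0 : ℝ) < l₂ ^ 2 := by positivity
  have hab : 4 * l₁ ^ 2 ≤ l₂ ^ 2 := by nlinarith
  -- the two cut-offs and the test function `Φ = Φ₁ Φ₂`
  obtain ⟨Φ₁, hΦ₁1, hΦ₁one, hΦ₁d0, hΦ₁nn, hΦ₁le, hΦ₁two, hΦ₁sign, hΦ₁dec⟩ :=
    exists_innerCut (β := 3 / 2 - α) hβ0 ha hD0 hD
  obtain ⟨Φ₂, hΦ₂1, hΦ₂one, hΦ₂zero, hΦ₂nn, hΦ₂le, hΦ₂d0, hΦ₂dle, hΦ₂d_half, hΦ₂d_b⟩ :=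
    exists_outerCut hb hD
  have hΦ1 : ContDiff ℝ 1 (fun t => Φ₁ t * Φ₂ t) := hΦ₁1.mul hΦ₂1
  have hΦT : ∀ t, l₂ ^ 2 ≤ t → (fun t => Φ₁ t * Φ₂ t) t = 0 := fun t ht => by
    simp only [hΦ₂zero t ht, mul_zero]
  have hΦd : ∀ t, deriv (fun t => Φ₁ t * Φ₂ t) t = deriv Φ₁ t * Φ₂ t + Φ₁ t * deriv Φ₂ t :=
    fun t => ((((hΦ₁1.differentiable one_ne_zero) t).hasDerivAt).mul
      (((hΦ₂1.differentiable one_ne_zero) t).hasDerivAt)).deriv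
  have hΦ₁sign' : ∀ t, (2 * α - 3) * Φ₁ t - 2 * t * deriv Φ₁ t ≤ 0 := fun t => by
    have := hΦ₁sign t
    rwa [show -(2 * (3 / 2 - α)) = 2 * α - 3 by ring] at this
  have key := h.localEnergy_identity_radial hα0 hΦ1 hΦT
  beta_reduce at key
  -- pointwise bounds
  have hP1 := twoScale_P1 (α := α) U rfl (by linarith : l₁ ^ 2 ≤ l₂ ^ 2 / 2) hΦ₁one hΦ₁d0
    hΦ₁sign' hΦ₂one hΦ₂nn hΦd
  have hP3 := twoScale_P3 U hl₁ hl₂0 rfl rfl hab (by linarith : (1 : ℝ) / 2 ≤ 3 / 2 - α) hD0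
    hΦ₁nn hΦ₁two hΦ₂d0 hΦ₂dle hΦ₂d_half hΦ₂d_b
  have hP2 := twoScale_P2 U P hl₁ hl₁₂ rfl rfl hab hD0 hK₂ hΦ₁d0 hΦ₁dec hΦ₁nn hΦ₁le hΦ₂nn
    hΦ₂le hΦ₂dle hΦ₂d_half hΦ₂d_b hΦd
  -- integrability of the pieces
  have hsuppL : ∀ {g : EuclideanSpace ℝ (Fin 3) → ℝ}, (∀ y, l₂ ^ 2 ≤ ‖y‖ ^ 2 → g y = 0) →
      HasCompactSupport g := by
    intro g hg
    refine HasCompactSupport.intro (isCompact_closedBall (0 : EuclideanSpace ℝ (Fin 3)) l₂)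
      fun y hy => hg y ?_
    rw [mem_closedBall_zero_iff, not_le] at hy
    exact pow_le_pow_left₀ hl₂0.le hy.le 2
  have hderiv_b : ∀ t, l₂ ^ 2 ≤ t → deriv (fun t => Φ₁ t * Φ₂ t) t = 0 := by
    intro t ht
    rw [hΦd t, hΦ₂d_b t ht, hΦ₂zero t ht]
    ring
  have hiL : Integrable (fun y : EuclideanSpace ℝ (Fin 3) =>
      ((2 * α - 3) * (Φ₁ (‖y‖ ^ 2) * Φ₂ (‖y‖ ^ 2)) -
        2 * ‖y‖ ^ 2 * deriv (fun t => Φ₁ t * Φ₂ t) (‖y‖ ^ 2)) * ‖U y‖ ^ 2) := by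
    have hc1 : Continuous fun y : EuclideanSpace ℝ (Fin 3) => Φ₁ (‖y‖ ^ 2) * Φ₂ (‖y‖ ^ 2) :=
      hΦ1.continuous.comp (continuous_norm.pow 2)
    have hc2 : Continuous fun y : EuclideanSpace ℝ (Fin 3) =>
        deriv (fun t => Φ₁ t * Φ₂ t) (‖y‖ ^ 2) :=
      hΦ1.continuous_deriv_one.comp (continuous_norm.pow 2)
    refine (((continuous_const.mul hc1).sub
      ((continuous_const.mul (continuous_norm.pow 2)).mul hc2)).mul (hUc.norm.pow 2))
      |>.integrable_of_hasCompactSupport (hsuppL fun y hy => ?_)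
    simp only [Pi.mul_apply, Pi.sub_apply, Pi.pow_apply]
    rw [hderiv_b _ hy, hΦ₂zero _ hy]
    ring
  have hiInd : Integrable (fun y => -(3 - 2 * α) *
      (ball (0 : EuclideanSpace ℝ (Fin 3)) l₁).indicator (fun y => ‖U y‖ ^ 2) y)
      (volume : Measure (EuclideanSpace ℝ (Fin 3))) := by
    refine Integrable.const_mul ?_ _
    exact (((hUc.norm.pow 2).continuousOn.integrableOn_compact
      (isCompact_closedBall (0 : EuclideanSpace ℝ (Fin 3)) l₁)).mono_set
      ball_subset_closedBall).integrable_indicator measurableSet_ball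
  have hiwt : Integrable (fun y : EuclideanSpace ℝ (Fin 3) =>
      2 * ‖y‖ ^ 2 * Φ₁ (‖y‖ ^ 2) * (-deriv Φ₂ (‖y‖ ^ 2)) * ‖U y‖ ^ 2) := by
    refine ((((continuous_const.mul (continuous_norm.pow 2)).mul
      (hΦ₁1.continuous.comp (continuous_norm.pow 2))).mul
      ((hΦ₂1.continuous_deriv_one.comp (continuous_norm.pow 2)).neg)).mul (hUc.norm.pow 2))
      |>.integrable_of_hasCompactSupport (hsuppL fun y hy => ?_)
    simp only [Pi.mul_apply, Pi.pow_apply, Pi.neg_apply, Function.comp_apply]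
    rw [hΦ₂d_b _ hy, neg_zero, mul_zero, zero_mul]
  have hSmeas : MeasurableSet ({y : EuclideanSpace ℝ (Fin 3) | l₂ ^ 2 / 2 ≤ ‖y‖ ^ 2} ∩
      closedBall (0 : EuclideanSpace ℝ (Fin 3)) l₂) :=
    ((isClosed_le continuous_const (continuous_norm.pow 2)).measurableSet).inter
      measurableSet_closedBall
  have hiS : Integrable (fun y => 8 * D * l₁ / l₂ *
      ({y : EuclideanSpace ℝ (Fin 3) | l₂ ^ 2 / 2 ≤ ‖y‖ ^ 2} ∩
        closedBall (0 : EuclideanSpace ℝ (Fin 3)) l₂).indicator (fun y => ‖U y‖ ^ 2) y)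
      (volume : Measure (EuclideanSpace ℝ (Fin 3))) := by
    refine Integrable.const_mul ?_ _
    exact (((hUc.norm.pow 2).continuousOn.integrableOn_compact
      (isCompact_closedBall (0 : EuclideanSpace ℝ (Fin 3)) l₂)).mono_set
      inter_subset_right).integrable_indicator hSmeas
  -- integrate (P1) and (P3)
  have hI1 : ∫ y : EuclideanSpace ℝ (Fin 3), ((2 * α - 3) * (Φ₁ (‖y‖ ^ 2) * Φ₂ (‖y‖ ^ 2)) -
        2 * ‖y‖ ^ 2 * deriv (fun t => Φ₁ t * Φ₂ t) (‖y‖ ^ 2)) * ‖U y‖ ^ 2 ≤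
      -(3 - 2 * α) * (∫ y in ball (0 : EuclideanSpace ℝ (Fin 3)) l₁, ‖U y‖ ^ 2) +
        ∫ y : EuclideanSpace ℝ (Fin 3),
          2 * ‖y‖ ^ 2 * Φ₁ (‖y‖ ^ 2) * (-deriv Φ₂ (‖y‖ ^ 2)) * ‖U y‖ ^ 2 := by
    rw [← integral_indicator measurableSet_ball, ← integral_const_mul,
      ← integral_add hiInd hiwt]
    exact integral_mono hiL (hiInd.add hiwt) hP1
  have hI3 : ∫ y : EuclideanSpace ℝ (Fin 3),
        2 * ‖y‖ ^ 2 * Φ₁ (‖y‖ ^ 2) * (-deriv Φ₂ (‖y‖ ^ 2)) * ‖U y‖ ^ 2 ≤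
      8 * D * l₁ / l₂ * ∫ y in {y : EuclideanSpace ℝ (Fin 3) | l₂ ^ 2 / 2 ≤ ‖y‖ ^ 2} ∩
        closedBall (0 : EuclideanSpace ℝ (Fin 3)) l₂, ‖U y‖ ^ 2 := by
    rw [← integral_indicator hSmeas, ← integral_const_mul]
    exact integral_mono hiwt hiS hP3
  -- Hölder on `S` and the tail
  have hSbdd : Bornology.IsBounded ({y : EuclideanSpace ℝ (Fin 3) | l₂ ^ 2 / 2 ≤ ‖y‖ ^ 2} ∩
      closedBall (0 : EuclideanSpace ℝ (Fin 3)) l₂) :=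
    isBounded_closedBall.subset inter_subset_right
  have hHolder := setIntegral_norm_sq_le_rpow_three hUc hSbdd
  have hτS : ∫ y in {y : EuclideanSpace ℝ (Fin 3) | l₂ ^ 2 / 2 ≤ ‖y‖ ^ 2} ∩
        closedBall (0 : EuclideanSpace ℝ (Fin 3)) l₂, ‖U y‖ ^ (3 : ℝ) ≤
      ∫ y in {y : EuclideanSpace ℝ (Fin 3) | l₂ ^ 2 / 2 ≤ ‖y‖ ^ 2}, ‖U y‖ ^ (3 : ℝ) :=
    setIntegral_mono_set hint3.integrableOn (ae_of_all _ fun y => by positivity)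
      (ae_of_all _ fun y hy => hy.1)
  have hτ0 : 0 ≤ ∫ y in {y : EuclideanSpace ℝ (Fin 3) | l₂ ^ 2 / 2 ≤ ‖y‖ ^ 2}, ‖U y‖ ^ (3 : ℝ) :=
    integral_nonneg fun y => by positivity
  have hvolS : (volume : Measure (EuclideanSpace ℝ (Fin 3))).real
      ({y : EuclideanSpace ℝ (Fin 3) | l₂ ^ 2 / 2 ≤ ‖y‖ ^ 2} ∩
        closedBall (0 : EuclideanSpace ℝ (Fin 3)) l₂) ≤
      (volume : Measure (EuclideanSpace ℝ (Fin 3))).real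
        (closedBall (0 : EuclideanSpace ℝ (Fin 3)) 1) * l₂ ^ 3 := by
    calc (volume : Measure (EuclideanSpace ℝ (Fin 3))).real
          ({y : EuclideanSpace ℝ (Fin 3) | l₂ ^ 2 / 2 ≤ ‖y‖ ^ 2} ∩
            closedBall (0 : EuclideanSpace ℝ (Fin 3)) l₂)
        ≤ (volume : Measure (EuclideanSpace ℝ (Fin 3))).real
            (closedBall (0 : EuclideanSpace ℝ (Fin 3)) l₂) :=
          measureReal_mono inter_subset_right measure_closedBall_lt_top.ne
      _ = (volume : Measure (EuclideanSpace ℝ (Fin 3))).real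
            (closedBall (0 : EuclideanSpace ℝ (Fin 3)) 1) * l₂ ^ 3 := by
          rw [Measure.addHaar_real_closedBall' volume (0 : EuclideanSpace ℝ (Fin 3)) hl₂0.le,
            finrank_euclideanSpace_fin, mul_comm]
  have hvolS' : ((volume : Measure (EuclideanSpace ℝ (Fin 3))).real
      ({y : EuclideanSpace ℝ (Fin 3) | l₂ ^ 2 / 2 ≤ ‖y‖ ^ 2} ∩
        closedBall (0 : EuclideanSpace ℝ (Fin 3)) l₂)) ^ (1 / 3 : ℝ) ≤
      ((volume : Measure (EuclideanSpace ℝ (Fin 3))).real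
        (closedBall (0 : EuclideanSpace ℝ (Fin 3)) 1)) ^ (1 / 3 : ℝ) * l₂ := by
    refine (Real.rpow_le_rpow measureReal_nonneg hvolS (by norm_num)).trans (le_of_eq ?_)
    rw [Real.mul_rpow hv₁ (by positivity), show (1 / 3 : ℝ) = ((3 : ℕ) : ℝ)⁻¹ by norm_num,
      Real.pow_rpow_inv_natCast hl₂0.le (by norm_num)]
  have hann : ∫ y : EuclideanSpace ℝ (Fin 3),
        2 * ‖y‖ ^ 2 * Φ₁ (‖y‖ ^ 2) * (-deriv Φ₂ (‖y‖ ^ 2)) * ‖U y‖ ^ 2 ≤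
      8 * D * l₁ * ((volume : Measure (EuclideanSpace ℝ (Fin 3))).real
          (closedBall (0 : EuclideanSpace ℝ (Fin 3)) 1)) ^ (1 / 3 : ℝ) *
        (∫ y in {y : EuclideanSpace ℝ (Fin 3) | l₂ ^ 2 / 2 ≤ ‖y‖ ^ 2}, ‖U y‖ ^ (3 : ℝ)) ^
          (1 / (3 / 2) : ℝ) := by
    have h1 : ∫ y in {y : EuclideanSpace ℝ (Fin 3) | l₂ ^ 2 / 2 ≤ ‖y‖ ^ 2} ∩
          closedBall (0 : EuclideanSpace ℝ (Fin 3)) l₂, ‖U y‖ ^ 2 ≤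
        (∫ y in {y : EuclideanSpace ℝ (Fin 3) | l₂ ^ 2 / 2 ≤ ‖y‖ ^ 2}, ‖U y‖ ^ (3 : ℝ)) ^
          (1 / (3 / 2) : ℝ) * (((volume : Measure (EuclideanSpace ℝ (Fin 3))).real
            (closedBall (0 : EuclideanSpace ℝ (Fin 3)) 1)) ^ (1 / 3 : ℝ) * l₂) := by
      refine hHolder.trans ?_
      have hτ' := Real.rpow_le_rpow (integral_nonneg fun y => by positivity) hτS
        (by norm_num : (0 : ℝ) ≤ 1 / (3 / 2))
      exact mul_le_mul hτ' hvolS' (Real.rpow_nonneg measureReal_nonneg _)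
        (Real.rpow_nonneg hτ0 _)
    refine hI3.trans ?_
    refine (mul_le_mul_of_nonneg_left h1 (by positivity)).trans (le_of_eq ?_)
    field_simp
  -- the flux
  have hup : ‖∫ y, (‖U y‖ ^ 2 + 2 * P y) *
        (2 * deriv (fun t => Φ₁ t * Φ₂ t) (‖y‖ ^ 2) * ⟪y, U y⟫)‖ ≤
      (2 * ((D + (3 / 2 - α)) * (2 : ℝ) ^ ((3 / 2 - α) + 1)) + 4 * D) / l₁ *
        ∫ y, (‖U y‖ ^ 3 + 2 * (|P y| * ‖U y‖)) := by
    rw [← integral_const_mul]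
    exact norm_integral_le_of_norm_le (hflux.const_mul _) (Eventually.of_forall hP2)
  -- combine
  have h1 := neg_le_abs (∫ y, (‖U y‖ ^ 2 + 2 * P y) *
    (2 * deriv (fun t => Φ₁ t * Φ₂ t) (‖y‖ ^ 2) * ⟪y, U y⟫))
  rw [← Real.norm_eq_abs] at h1
  have hα' : 0 ≤ 1 + α := by linarith
  have h2 : -((1 + α) * ∫ y, (‖U y‖ ^ 2 + 2 * P y) *
        (2 * deriv (fun t => Φ₁ t * Φ₂ t) (‖y‖ ^ 2) * ⟪y, U y⟫)) ≤
      (1 + α) * ((2 * ((D + (3 / 2 - α)) * (2 : ℝ) ^ ((3 / 2 - α) + 1)) + 4 * D) / l₁ *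
        ∫ y, (‖U y‖ ^ 3 + 2 * (|P y| * ‖U y‖))) := by
    rw [← mul_neg]
    exact mul_le_mul_of_nonneg_left (h1.trans hup) hα'
  linarith [hI1, key, hann, h2]

/-- **Chae–Shvydkoy 2013, Theorem 3.2 at `p = 3`, range `−1 < α ≤ 1 = N/p`, proved.** A
stationary self-similar Euler profile `(U, P)` with exponent `γ = 1/(α+1)`, `−1 < α ≤ 1`,
`U ∈ C² ∩ L³(ℝ³)` and `P ∈ L^{3/2}(ℝ³)` is trivial. Proof (CS13 §3.2.1 at `p = 3`, where no
bootstrap is needed: `β_3 = N − 1 − 3N/p = −1 < 0`): the radial local energy identity with the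
test function `Φ(t) = ψ_β(t/l₁²) σ(2 − 2t/l₂²)`, `β = 3/2 − α ≥ 1/2` (CS13's family
`∫ l^{2α−4}σ(y/l) dl`, (2.13)–(3.2), in closed form), gives the two-scale inequality
`twoScale_ineq`; `l₂ → ∞` kills the large-scale term (this is where `α ≤ 1` enters), so ball
energies are `≲ 1/l₁ → 0`. The associated-pressure formula (2.3) is not needed at `p = 3`
(only `P ∈ L^{3/2}`). [cite: ChaeShvydkoy2013, §3.2.1 (Thm. 3.2, range −1 < α ≤ N/p, p = 3)] -/
theorem IsSelfSimilarEulerProfile.eq_zero_of_memLp_three_of_le_one {α : ℝ}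
    {U : EuclideanSpace ℝ (Fin 3) → EuclideanSpace ℝ (Fin 3)} {P : EuclideanSpace ℝ (Fin 3) → ℝ}
    (h : IsSelfSimilarEulerProfile (1 / (α + 1)) 0 U P) (hα : -1 < α) (hα1 : α ≤ 1)
    (hU3 : MemLp U 3 volume) (hP : MemLp P (3 / 2 : ℝ≥0∞) volume) : U = 0 := by
  have hUc : Continuous U := h.contDiff_velocity.continuous
  obtain ⟨D, hD0, hD⟩ := Calculus.exists_bound_deriv_smoothTransition
  set K : ℝ := 2 * ((D + (3 / 2 - α)) * (2 : ℝ) ^ ((3 / 2 - α) + 1)) + 4 * D with hK_def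
  set If : ℝ := ∫ y, (‖U y‖ ^ 3 + 2 * (|P y| * ‖U y‖)) with hIf_def
  set v₁ : ℝ := (volume : Measure (EuclideanSpace ℝ (Fin 3))).real
    (closedBall (0 : EuclideanSpace ℝ (Fin 3)) 1) with hv₁_def
  set τ : ℝ → ℝ := fun l₂ => ∫ y in {y : EuclideanSpace ℝ (Fin 3) | l₂ ^ 2 / 2 ≤ ‖y‖ ^ 2},
    ‖U y‖ ^ (3 : ℝ) with hτ_def
  -- Step A: the two-scale inequality (`twoScale_ineq`)
  have hstep : ∀ l₁ : ℝ, 0 < l₁ → ∀ l₂ : ℝ, max (2 * l₁) 1 ≤ l₂ →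
      (3 - 2 * α) * ∫ y in ball (0 : EuclideanSpace ℝ (Fin 3)) l₁, ‖U y‖ ^ 2 ≤
        8 * D * l₁ * v₁ ^ (1 / 3 : ℝ) * (τ l₂) ^ (1 / (3 / 2) : ℝ) + (1 + α) * (K / l₁ * If) :=
    fun l₁ hl₁ l₂ hl₂ => h.twoScale_ineq hα hα1 hU3 hP hD0 hD hl₁ hl₂
  -- Step B: let `l₂ → ∞`
  have hτlim : Tendsto (fun l₂ : ℝ => (τ l₂) ^ (1 / (3 / 2) : ℝ)) atTop (𝓝 0) := by
    have h1 : Tendsto (fun l₂ : ℝ => l₂ ^ 2 / 2) atTop atTop :=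
      (tendsto_pow_atTop two_ne_zero).atTop_div_const (by norm_num)
    have h2 : Tendsto τ atTop (𝓝 0) := (tendsto_tail_integral_norm_cube hU3).comp h1
    have h3 := h2.rpow_const (p := (1 / (3 / 2) : ℝ)) (Or.inr (by norm_num))
    rwa [Real.zero_rpow (by norm_num)] at h3
  have hball : ∀ l₁ : ℝ, 0 < l₁ →
      ∫ y in ball (0 : EuclideanSpace ℝ (Fin 3)) l₁, ‖U y‖ ^ 2 ≤
        (1 + α) * (K * If) / (3 - 2 * α) / l₁ := by
    intro l₁ hl₁
    have hα3 : 0 < 3 - 2 * α := by linarith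
    have hlim : Tendsto (fun l₂ : ℝ => 8 * D * l₁ * v₁ ^ (1 / 3 : ℝ) * (τ l₂) ^ (1 / (3 / 2) : ℝ) +
        (1 + α) * (K / l₁ * If)) atTop (𝓝 (0 + (1 + α) * (K / l₁ * If))) := by
      have := (hτlim.const_mul (8 * D * l₁ * v₁ ^ (1 / 3 : ℝ))).add_const
        ((1 + α) * (K / l₁ * If))
      rwa [mul_zero] at this
    have hle : (3 - 2 * α) * ∫ y in ball (0 : EuclideanSpace ℝ (Fin 3)) l₁, ‖U y‖ ^ 2 ≤
        0 + (1 + α) * (K / l₁ * If) :=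
      ge_of_tendsto hlim (by
        filter_upwards [eventually_ge_atTop (max (2 * l₁) 1)] with l₂ hl₂
        exact hstep l₁ hl₁ l₂ hl₂)
    rw [zero_add] at hle
    rw [le_div_iff₀ hl₁, le_div_iff₀ hα3]
    calc (∫ y in ball (0 : EuclideanSpace ℝ (Fin 3)) l₁, ‖U y‖ ^ 2) * l₁ * (3 - 2 * α)
        = (3 - 2 * α) * (∫ y in ball (0 : EuclideanSpace ℝ (Fin 3)) l₁, ‖U y‖ ^ 2) * l₁ := by
          ring
      _ ≤ (1 + α) * (K / l₁ * If) * l₁ := by gcongr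
      _ = (1 + α) * (K * If) := by field_simp
  -- Step C: conclude (energy growth bound with exponent `2 > 3/2`)
  set C₀ : ℝ := (1 + α) * (K * If) / (3 - 2 * α) with hC₀_def
  refine eq_zero_of_energyGrowth_of_three_halves_lt (α := 2) (C := C₀) (L₀ := 1)
    (by norm_num) hUc fun R hR => ?_
  have hR : 0 < R := by linarith
  calc ∫ y in ball (0 : EuclideanSpace ℝ (Fin 3)) R, ‖U y‖ ^ 2 ≤ C₀ / R := hball R hR
    _ = C₀ * R ^ (3 - 2 * (2 : ℝ)) := by
        rw [show (3 : ℝ) - 2 * 2 = -1 by norm_num, Real.rpow_neg_one, div_eq_mul_inv]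

/-! ## Theorem 3.2 at `p = 3`: both ranges, and the Riesz-pressure form -/

/-- **Chae–Shvydkoy 2013, Theorem 3.2 at `p = 3` ("the `L³` case natural for the Navier–Stokes
equations"), proved.** A stationary self-similar Euler profile `(U, P)` with exponent
`γ = 1/(α+1)`, `U ∈ C² ∩ L³(ℝ³)`, `P ∈ L^{3/2}(ℝ³)` and `−1 < α ≤ 1` or `α > 3/2` is trivial.
This is the `p = 3` slice of the named fact `chaeShvydkoy2013_Lp_exclusion`
(`SelfSimilarEulerLpExclusion.lean`), with the associated-pressure hypothesis (2.3) dropped: at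
`p = 3` only `P ∈ L^{3/2}` is used (CS13 need (2.3) for the pressure growth Lemma 3.3 of the
bootstrap, which is void at `p = 3`). The window `1 < α ≤ 3/2` is NOT covered (there Cor. 3.4
holds instead). [cite: ChaeShvydkoy2013, §3.2 Thm. 3.2 (p = 3)] -/
theorem chaeShvydkoy2013_L3_exclusion (α : ℝ)
    (U : EuclideanSpace ℝ (Fin 3) → EuclideanSpace ℝ (Fin 3)) (P : EuclideanSpace ℝ (Fin 3) → ℝ)
    (hα : -1 < α) (hrange : α ≤ 1 ∨ 3 / 2 < α)
    (hprof : IsSelfSimilarEulerProfile (1 / (α + 1)) 0 U P) (hU3 : MemLp U 3 volume)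
    (hP : MemLp P (3 / 2 : ℝ≥0∞) volume) : U = 0 := by
  rcases hrange with h1 | h2
  · exact hprof.eq_zero_of_memLp_three_of_le_one hα h1 hU3 hP
  · exact hprof.eq_zero_of_memLp_three_of_gt_three_halves h2 hU3 hP

/-- **The `p = 3` instance of the named fact `chaeShvydkoy2013_Lp_exclusion`, verbatim, is a
theorem** (its weak-Poisson hypothesis is not even needed). [cite: ChaeShvydkoy2013, §3.2 Thm. 3.2 (p = 3)] -/
theorem chaeShvydkoy2013_Lp_exclusion_three (α : ℝ)
    (U : EuclideanSpace ℝ (Fin 3) → EuclideanSpace ℝ (Fin 3)) (P : EuclideanSpace ℝ (Fin 3) → ℝ)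
    (hα : -1 < α) (_h3 : (3 : ℝ≥0∞) ≤ 3) (_h3' : (3 : ℝ≥0∞) ≠ ∞)
    (hrange : α ≤ 3 / (3 : ℝ≥0∞).toReal ∨ 3 / 2 < α)
    (hprof : IsSelfSimilarEulerProfile (1 / (α + 1)) 0 U P)
    (hU : MemLp U 3 volume) (hP : MemLp P (3 / 2) volume)
    (_hPoisson : ∀ φ : EuclideanSpace ℝ (Fin 3) → ℝ, ContDiff ℝ (⊤ : ℕ∞) φ → HasCompactSupport φ →
      ∫ x, P x * (Δ φ) x = -∫ x, fderiv ℝ (fderiv ℝ φ) x (U x) (U x)) :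
    U = 0 := by
  refine chaeShvydkoy2013_L3_exclusion α U P hα ?_ hprof hU hP
  have h3 : (3 : ℝ) / (3 : ℝ≥0∞).toReal = 1 := by norm_num
  rwa [h3] at hrange

/-- **Theorem 3.2 at `p = 3` with the tree's Riesz pressure, unconditionally** (the hypothesis
`(h : chaeShvydkoy2013_Lp_exclusion)` of `chaeShvydkoy2013_Lp_exclusion.of_rieszPressure`
removed): a stationary self-similar Euler profile `(U, P)` with exponent `1/(α+1)`,
`U ∈ L³(ℝ³)`, `P = Π[U]` a.e. (`rieszPressure`, `RieszPressureL3.lean`; `Π[U] ∈ L^{3/2}` is the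
tree's `memLp_rieszPressure`), and `−1 < α ≤ 1` or `α > 3/2`, is trivial.
[cite: ChaeShvydkoy2013, §3.2 Thm. 3.2 (p = 3)] -/
theorem IsSelfSimilarEulerProfile.eq_zero_of_memLp_three_of_rieszPressure {α : ℝ}
    {U : EuclideanSpace ℝ (Fin 3) → EuclideanSpace ℝ (Fin 3)} {P : EuclideanSpace ℝ (Fin 3) → ℝ}
    (hprof : IsSelfSimilarEulerProfile (1 / (α + 1)) 0 U P) (hα : -1 < α)
    (hrange : α ≤ 1 ∨ 3 / 2 < α) (hU3 : MemLp U 3 volume)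
    (hP : P =ᵐ[volume] rieszPressure U) : U = 0 :=
  chaeShvydkoy2013_L3_exclusion α U P hα hrange hprof hU3 ((memLp_rieszPressure hU3).ae_eq hP.symm)

/-! ## Corollary in the vocabulary of Constantin–Ignatova–Vicol 2026: the far-field bounds (3.8)
put the profile in `L³` exactly when `γ < 1/2`, so (3.8) + associated pressure + `γ < 2/5` is
excluded -/

/-- **A CIV far field with `γ < 1/2` is an `L³` profile.** If `|U(y)| ≤ C|y|⟨y⟩^{−1/γ}`
(`HasSelfSimilarFarFieldWith γ 0 C U`, CIV 2026 (3.8)) with `0 < γ < 1/2` and `U` is continuous,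
then `U ∈ L³(ℝ³)`: `|U| ≤ C⟨y⟩^{1−1/γ}` and `⟨y⟩^{3(1−1/γ)}` is integrable iff `3(1/γ − 1) > 3`,
i.e. `γ < 1/2` (Mathlib `integrable_rpow_neg_one_add_norm_sq`). For `γ ≥ 1/2` the printed far
field `|U| ∼ |y|^{(γ−1)/γ}` is NOT in `L³` (e.g. `γ = 1/2`: `|U| ∼ |y|^{−1}`, the `L³_weak` border
case of CS13 §3.2). [cite: ConstantinIgnatovaVicol2026Putative, §3.1.3 eq. (3.8)] -/
theorem HasSelfSimilarFarFieldWith.memLp_three {γ C : ℝ}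
    {U : EuclideanSpace ℝ (Fin 3) → EuclideanSpace ℝ (Fin 3)}
    (h : HasSelfSimilarFarFieldWith γ 0 C U) (hγ : 0 < γ) (hγ' : γ < 1 / 2) (hU : Continuous U) :
    MemLp U 3 volume := by
  -- the dominating radial function `g(y) = C ⟨y⟩^{1 − 1/γ} = C (1+|y|²)^{−s/2}`, `s = 1/γ − 1 > 1`
  set s : ℝ := 1 / γ - 1 with hs_def
  have hs1 : 1 < s := by
    rw [hs_def, lt_sub_iff_add_lt, lt_div_iff₀ hγ]
    linarith
  have hC : 0 ≤ C := h.nonneg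
  set g : EuclideanSpace ℝ (Fin 3) → ℝ := fun y => C * (1 + ‖y‖ ^ 2) ^ (-s / 2) with hg_def
  have hg_nonneg : ∀ y, 0 ≤ g y := fun y => by
    have : 0 < (1 + ‖y‖ ^ 2) ^ (-s / 2) := Real.rpow_pos_of_pos (by positivity) _
    exact mul_nonneg hC this.le
  -- `g ∈ L³`
  have hg3 : MemLp g 3 (volume : Measure (EuclideanSpace ℝ (Fin 3))) := by
    have hgm : AEStronglyMeasurable g (volume : Measure (EuclideanSpace ℝ (Fin 3))) := by
      refine (continuous_const.mul ?_).aestronglyMeasurable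
      exact (continuous_const.add (continuous_norm.pow 2)).rpow_const fun y =>
        Or.inl (ne_of_gt (add_pos_of_pos_of_nonneg one_pos (sq_nonneg ‖y‖)))
    refine (integrable_norm_rpow_iff hgm (by norm_num) (by norm_num)).1 ?_
    have h3s : (Module.finrank ℝ (EuclideanSpace ℝ (Fin 3)) : ℝ) < 3 * s := by
      rw [finrank_euclideanSpace_fin]
      push_cast
      linarith
    have hint := (integrable_rpow_neg_one_add_norm_sq
      (μ := (volume : Measure (EuclideanSpace ℝ (Fin 3)))) h3s).const_mul (C ^ 3)
    refine hint.congr (Eventually.of_forall fun y => ?_)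
    have hb : 0 < 1 + ‖y‖ ^ 2 := by positivity
    simp only [hg_def, ENNReal.toReal_ofNat, Real.norm_eq_abs]
    rw [abs_of_nonneg (hg_nonneg y), Real.mul_rpow hC (Real.rpow_nonneg hb.le _),
      ← Real.rpow_mul hb.le, show -s / 2 * (3 : ℝ) = -(3 * s) / 2 by ring,
      show (C : ℝ) ^ (3 : ℝ) = C ^ (3 : ℕ) from by exact_mod_cast Real.rpow_natCast C 3]
  -- domination `|U| ≤ g`
  refine hg3.of_le hU.aestronglyMeasurable (Eventually.of_forall fun y => ?_)
  rw [Real.norm_eq_abs, abs_of_nonneg (hg_nonneg y), hg_def]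
  have h1 := h.norm_le y
  rw [sub_zero] at h1
  have hb : 0 < 1 + ‖y‖ ^ 2 := by positivity
  have hsplit : (1 + ‖y‖ ^ 2) ^ (-s / 2) =
      (1 + ‖y‖ ^ 2) ^ (1 / 2 : ℝ) * (1 + ‖y‖ ^ 2) ^ (-(1 / (2 * γ))) := by
    rw [← Real.rpow_add hb]
    congr 1
    rw [hs_def]
    field_simp
    ring
  have hy : ‖y‖ ≤ (1 + ‖y‖ ^ 2) ^ (1 / 2 : ℝ) := by
    rw [← Real.sqrt_eq_rpow]
    calc ‖y‖ = Real.sqrt (‖y‖ ^ 2) := (Real.sqrt_sq (norm_nonneg _)).symm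
      _ ≤ Real.sqrt (1 + ‖y‖ ^ 2) := Real.sqrt_le_sqrt (by linarith)
  have hw : 0 ≤ (1 + ‖y‖ ^ 2) ^ (-(1 / (2 * γ))) := Real.rpow_nonneg hb.le _
  calc ‖U y‖ ≤ C * ‖y‖ * (1 + ‖y‖ ^ 2) ^ (-(1 / (2 * γ))) := h1
    _ ≤ C * (1 + ‖y‖ ^ 2) ^ (1 / 2 : ℝ) * (1 + ‖y‖ ^ 2) ^ (-(1 / (2 * γ))) := by gcongr
    _ = C * (1 + ‖y‖ ^ 2) ^ (-s / 2) := by rw [hsplit, mul_assoc]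

/-- **No exact self-similar Euler collapse with the CIV far field (3.8), associated pressure and
exponent `γ < 2/5`.** A stationary self-similar Euler profile `(U, P)` with exponent `0 < γ < 2/5`,
centre `0`, Constantin–Ignatova–Vicol far-field bounds (3.8) and pressure `P = Π[U]` a.e. is
trivial — Chae–Shvydkoy 2013 Thm 3.2 at `p = 3` in the range `α = 1/γ − 1 > 3/2` (the profile
is in `L³` by `HasSelfSimilarFarFieldWith.memLp_three`). The range `2/5 ≤ γ < 1/2`
(`1 < α ≤ 3/2`) is Chae–Shvydkoy's open window; for `γ ≥ 1/2` the far field (3.8) is not `L³`.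
[cite: ChaeShvydkoy2013, §3.2 Thm. 3.2 (p = 3, α > N/2)] -/
theorem IsSelfSimilarEulerProfile.eq_zero_of_farField_of_lt_two_fifths {γ C : ℝ}
    {U : EuclideanSpace ℝ (Fin 3) → EuclideanSpace ℝ (Fin 3)} {P : EuclideanSpace ℝ (Fin 3) → ℝ}
    (hprof : IsSelfSimilarEulerProfile γ 0 U P) (hγ : 0 < γ) (hγ' : γ < 2 / 5)
    (hfar : HasSelfSimilarFarFieldWith γ 0 C U) (hP : P =ᵐ[volume] rieszPressure U) : U = 0 := by
  have hU3 : MemLp U 3 volume :=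
    hfar.memLp_three hγ (by linarith) hprof.contDiff_velocity.continuous
  have hγeq : 1 / ((1 / γ - 1) + 1) = γ := by
    field_simp
    ring
  have hprof' : IsSelfSimilarEulerProfile (1 / ((1 / γ - 1) + 1)) 0 U P := by rwa [hγeq]
  refine hprof'.eq_zero_of_memLp_three_of_rieszPressure (α := 1 / γ - 1) ?_ (Or.inr ?_) hU3 hP
  · have : 0 < 1 / γ := by positivity
    linarith
  · rw [lt_sub_iff_add_lt, lt_div_iff₀ hγ]
    linarith

/-- The same with the pressure hypothesis in the form `P ∈ L^{3/2}(ℝ³)` (any pressure profile of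
that integrability; the associated one `Π[U]` is such). [cite: ChaeShvydkoy2013, §3.2 Thm. 3.2 (p = 3, α > N/2)] -/
theorem IsSelfSimilarEulerProfile.eq_zero_of_farField_of_lt_two_fifths' {γ C : ℝ}
    {U : EuclideanSpace ℝ (Fin 3) → EuclideanSpace ℝ (Fin 3)} {P : EuclideanSpace ℝ (Fin 3) → ℝ}
    (hprof : IsSelfSimilarEulerProfile γ 0 U P) (hγ : 0 < γ) (hγ' : γ < 2 / 5)
    (hfar : HasSelfSimilarFarFieldWith γ 0 C U) (hP : MemLp P (3 / 2 : ℝ≥0∞) volume) : U = 0 := by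
  have hU3 : MemLp U 3 volume :=
    hfar.memLp_three hγ (by linarith) hprof.contDiff_velocity.continuous
  have hγeq : 1 / ((1 / γ - 1) + 1) = γ := by
    field_simp
    ring
  have hprof' : IsSelfSimilarEulerProfile (1 / ((1 / γ - 1) + 1)) 0 U P := by rwa [hγeq]
  refine hprof'.eq_zero_of_memLp_three_of_gt_three_halves (α := 1 / γ - 1) ?_ hU3 hP
  rw [lt_sub_iff_add_lt, lt_div_iff₀ hγ]
  linarith

/-! ## Corollary 3.4 at `p = 3` in the open window `1 < α < 3/2`: the energy growth bound
`∫_{|y|<L} |U|² ≲ L^{3−2α}` -/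

/-- `x ↦ (x₊)²` is differentiable with derivative `2x₊`. [folklore] -/
private theorem hasDerivAt_posPart_sq (x : ℝ) :
    HasDerivAt (fun x : ℝ => max x 0 ^ 2) (2 * max x 0) x := by
  rcases lt_trichotomy x 0 with hx | hx | hx
  · have hev : (fun x : ℝ => max x 0 ^ 2) =ᶠ[𝓝 x] fun _ => (0 : ℝ) := by
      filter_upwards [Iio_mem_nhds hx] with y hy
      rw [max_eq_right (le_of_lt hy)]
      ring
    rw [max_eq_right hx.le, mul_zero]
    exact (hasDerivAt_const x (0 : ℝ)).congr_of_eventuallyEq hev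
  · subst hx
    rw [max_self, mul_zero, hasDerivAt_iff_isLittleO_nhds_zero]
    refine Asymptotics.isLittleO_iff.2 fun c hc => ?_
    filter_upwards [Icc_mem_nhds (by linarith : -c < (0 : ℝ)) hc] with h hh
    have h1 : |max h 0| ≤ |h| := by
      rcases le_or_gt h 0 with h0 | h0
      · rw [max_eq_right h0, abs_zero]
        exact abs_nonneg _
      · rw [max_eq_left h0.le]
    have h2 : |h| ≤ c := abs_le.2 ⟨hh.1, hh.2⟩
    have e : (fun x : ℝ => max x 0 ^ 2) (0 + h) - (fun x : ℝ => max x 0 ^ 2) 0 - h • (0 : ℝ) =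
        max h 0 ^ 2 := by simp
    rw [e, Real.norm_eq_abs, Real.norm_eq_abs, abs_pow]
    calc |max h 0| ^ 2 = |max h 0| * |max h 0| := sq _
      _ ≤ |h| * |h| := by gcongr
      _ ≤ c * |h| := by gcongr
  · have hev : (fun x : ℝ => max x 0 ^ 2) =ᶠ[𝓝 x] fun y => y ^ 2 := by
      filter_upwards [Ioi_mem_nhds hx] with y hy
      rw [max_eq_left (le_of_lt hy)]
    rw [max_eq_left hx.le]
    have h := (hasDerivAt_pow 2 x).congr_of_eventuallyEq hev
    simpa using h

/-- `x ↦ (x₊)²` is `C¹`. [folklore] -/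
private theorem contDiff_posPart_sq : ContDiff ℝ 1 fun x : ℝ => max x 0 ^ 2 := by
  rw [contDiff_one_iff_deriv]
  refine ⟨fun x => (hasDerivAt_posPart_sq x).differentiableAt, ?_⟩
  have : deriv (fun x : ℝ => max x 0 ^ 2) = fun x => 2 * max x 0 :=
    funext fun x => (hasDerivAt_posPart_sq x).deriv
  rw [this]
  exact continuous_const.mul (continuous_id.max continuous_const)

/-- **The polynomial outer profile, packaged.** For `b > 0`, `Φ₂(t) = ((1 − t/b)₊)²` is `C¹`,
vanishes on `t ≥ b`, is `≥ 0`, and for `0 ≤ t`: `Φ₂ ≤ 1`, `|Φ₂'| ≤ 2/b`; `Φ₂' ≤ 0` everywhere,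
`Φ₂' = 0` on `t ≥ b`, and `−Φ₂'(t) ≥ 1/b` on `t ≤ b/2`. [folklore] -/
private theorem exists_polyCut {b : ℝ} (hb : 0 < b) :
    ∃ Φ₂ : ℝ → ℝ, ContDiff ℝ 1 Φ₂ ∧ (∀ t, b ≤ t → Φ₂ t = 0) ∧ (∀ t, 0 ≤ Φ₂ t) ∧
      (∀ t, 0 ≤ t → Φ₂ t ≤ 1) ∧ (∀ t, deriv Φ₂ t ≤ 0) ∧ (∀ t, 0 ≤ t → |deriv Φ₂ t| ≤ 2 / b) ∧
      (∀ t, b ≤ t → deriv Φ₂ t = 0) ∧ (∀ t, t ≤ b / 2 → 1 / b ≤ -deriv Φ₂ t) := by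
  have hd : ∀ t, HasDerivAt (fun t : ℝ => max (1 - t / b) 0 ^ 2)
      (2 * max (1 - t / b) 0 * (-(1 / b))) t := fun t => by
    have h1 : HasDerivAt (fun t : ℝ => 1 - t / b) (-(1 / b)) t := by
      simpa using ((hasDerivAt_id t).div_const b).const_sub 1
    exact (hasDerivAt_posPart_sq (1 - t / b)).comp t h1
  have hle1 : ∀ t, 0 ≤ t → max (1 - t / b) 0 ≤ 1 := fun t ht =>
    max_le (by have : 0 ≤ t / b := div_nonneg ht hb.le; linarith) zero_le_one
  refine ⟨fun t => max (1 - t / b) 0 ^ 2,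
    contDiff_posPart_sq.comp (contDiff_const.sub (contDiff_id.div_const b)),
    ?_, fun t => sq_nonneg _, ?_, ?_, ?_, ?_, ?_⟩
  · intro t ht
    have : 1 - t / b ≤ 0 := by rw [sub_nonpos, le_div_iff₀ hb]; linarith
    simp [max_eq_right this]
  · intro t ht
    have h0 : 0 ≤ max (1 - t / b) 0 := le_max_right _ _
    nlinarith [hle1 t ht]
  · intro t
    rw [(hd t).deriv]
    have h0 : 0 ≤ max (1 - t / b) 0 := le_max_right _ _
    have : 0 < 1 / b := by positivity
    nlinarith
  · intro t ht
    rw [(hd t).deriv, show 2 * max (1 - t / b) 0 * -(1 / b) = -(2 / b * max (1 - t / b) 0) by ring,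
      abs_neg, abs_of_nonneg (by positivity)]
    calc 2 / b * max (1 - t / b) 0 ≤ 2 / b * 1 := by gcongr; exact hle1 t ht
      _ = 2 / b := mul_one _
  · intro t ht
    rw [(hd t).deriv]
    have : 1 - t / b ≤ 0 := by rw [sub_nonpos, le_div_iff₀ hb]; linarith
    simp [max_eq_right this]
  · intro t ht
    rw [(hd t).deriv]
    have h1 : 1 / 2 ≤ 1 - t / b := by
      have : t / b ≤ 1 / 2 := by rw [div_le_iff₀ hb]; linarith
      linarith
    rw [max_eq_left (by linarith)]
    have hb' : 0 < 1 / b := by positivity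
    nlinarith

/-- **The inner cut-off, packaged with the extra facts used in the window**: `Φ₁ = ψ_β(t/a)` is
`C¹`, `Φ₁' = 0` on `t ≤ a`, `0 ≤ Φ₁ ≤ 2^β` on `t > 0`, `Φ₁ = (t/(2a))^{−β}` on `t ≥ 2a`, the defect
`κ₁ = −2βΦ₁ − 2tΦ₁'` satisfies `−(2β + 4D·2^β) ≤ κ₁ ≤ 0` and `κ₁ = 0` on `t ≥ 2a`, and
`t|Φ₁'| ≤ (D+β)2^{β+1}` on `t ≥ a`. [folklore] -/
private theorem exists_innerCut₂ {β a D : ℝ} (hβ : 0 ≤ β) (ha : 0 < a) (hD0 : 0 ≤ D)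
    (hD : ∀ r, |deriv Real.smoothTransition r| ≤ D) :
    ∃ Φ₁ : ℝ → ℝ, ContDiff ℝ 1 Φ₁ ∧ (∀ t, t ≤ a → deriv Φ₁ t = 0) ∧
      (∀ t, 0 < t → 0 ≤ Φ₁ t) ∧ (∀ t, 0 < t → Φ₁ t ≤ (2 : ℝ) ^ β) ∧
      (∀ t, 2 * a ≤ t → Φ₁ t = (t / a / 2) ^ (-β)) ∧
      (∀ t, -(2 * β) * Φ₁ t - 2 * t * deriv Φ₁ t ≤ 0) ∧
      (∀ t, 2 * a ≤ t → -(2 * β) * Φ₁ t - 2 * t * deriv Φ₁ t = 0) ∧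
      (∀ t, -(2 * β + 4 * D * (2 : ℝ) ^ β) ≤ -(2 * β) * Φ₁ t - 2 * t * deriv Φ₁ t) ∧
      (∀ t, a ≤ t → |deriv Φ₁ t| * t ≤ (D + β) * (2 : ℝ) ^ (β + 1)) := by
  set ψ : ℝ → ℝ := fun s => 1 + Real.smoothTransition (s - 1) * ((s / 2) ^ (-β) - 1) with hψ
  have hψ1 : ContDiff ℝ 1 ψ := inner_contDiff β
  have hd : ∀ t, HasDerivAt (fun t => ψ (t / a)) (deriv ψ (t / a) * (1 / a)) t := fun t =>
    ((hψ1.differentiable one_ne_zero) _).hasDerivAt.comp t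
      (by simpa using (hasDerivAt_id t).div_const a)
  have h2β : (1 : ℝ) ≤ 2 ^ β := Real.one_le_rpow (by norm_num) hβ
  have hhalf : (1 / 2 : ℝ) ^ (-β) = 2 ^ β := by
    rw [one_div, Real.inv_rpow (by norm_num), Real.rpow_neg (by norm_num), inv_inv]
  -- `g = (s/2)^{−β} ≤ 2^β` for `s ≥ 1`, `≥ 1` for `0 < s ≤ 2`
  have hg_le : ∀ s : ℝ, 1 ≤ s → (s / 2) ^ (-β) ≤ (2 : ℝ) ^ β := fun s hs => by
    have h1' : (s / 2) ^ (-β) ≤ (1 / 2 : ℝ) ^ (-β) :=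
      Real.rpow_le_rpow_of_nonpos (by norm_num) (by linarith) (by linarith)
    rwa [hhalf] at h1'
  have hg_ge : ∀ s : ℝ, 0 < s → s ≤ 2 → 1 ≤ (s / 2) ^ (-β) := fun s hs hs2 =>
    Real.one_le_rpow_of_pos_of_le_one_of_nonpos (by positivity) (by linarith) (by linarith)
  -- the key identity `−2βΦ₁ − 2tΦ₁' = −2(βψ(s) + sψ'(s))`, `s = t/a`
  have hκ : ∀ t, -(2 * β) * ψ (t / a) - 2 * t * (deriv ψ (t / a) * (1 / a)) =
      -2 * (β * ψ (t / a) + t / a * deriv ψ (t / a)) := fun t => by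
    field_simp
    ring
  -- `βψ + sψ'` in closed form for `s > 0`
  have hform : ∀ s : ℝ, 0 < s → β * ψ s + s * deriv ψ s =
      β * (1 - Real.smoothTransition (s - 1)) +
        s * deriv Real.smoothTransition (s - 1) * ((s / 2) ^ (-β) - 1) := by
    intro s hs
    have hne : (s / 2 : ℝ) ≠ 0 := by positivity
    have hsg : s * (1 / 2 * (-β) * (s / 2) ^ (-β - 1)) = -β * (s / 2) ^ (-β) := by
      have : (s / 2) ^ (-β) = (s / 2) ^ (-β - 1) * (s / 2) := by
        rw [← Real.rpow_add_one hne]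
        ring_nf
      rw [this]
      ring
    simp only [hψ]
    rw [inner_deriv]
    linear_combination (Real.smoothTransition (s - 1)) * hsg
  refine ⟨fun t => ψ (t / a), hψ1.comp (contDiff_id.div_const a), ?_, ?_, ?_, ?_, ?_, ?_, ?_, ?_⟩
  · intro t ht
    rw [(hd t).deriv, show deriv ψ (t / a) = 0 from inner_deriv_eq_zero (by rwa [div_le_one ha]),
      zero_mul]
  · intro t ht
    exact inner_nonneg (by positivity)
  · intro t ht
    have hs : 0 < t / a := by positivity
    by_cases h1 : t / a ≤ 1
    · simp only [hψ]
      rw [inner_eq_one h1]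
      exact h2β
    · push Not at h1
      have hT0 := Real.smoothTransition.nonneg (t / a - 1)
      have hT1 := Real.smoothTransition.le_one (t / a - 1)
      have hg := hg_le (t / a) h1.le
      simp only [hψ]
      nlinarith [mul_nonneg hT0 (sub_nonneg.2 hg), mul_nonneg (sub_nonneg.2 hT1) (sub_nonneg.2 h2β)]
  · intro t ht
    exact inner_eq_rpow (by rw [le_div_iff₀ ha]; linarith)
  · intro t
    rw [(hd t).deriv, hκ]
    have := inner_sign hβ (t / a)
    simp only [hψ] at this ⊢
    linarith
  · intro t ht
    rw [(hd t).deriv, hκ]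
    have hs : 2 ≤ t / a := by rw [le_div_iff₀ ha]; linarith
    have hs0 : 0 < t / a := by linarith
    rw [hform _ hs0, Real.smoothTransition.one_of_one_le (by linarith),
      Calculus.deriv_smoothTransition_of_one_le (by linarith)]
    ring
  · intro t
    rw [(hd t).deriv, hκ]
    have h4D : 0 ≤ 4 * D * (2 : ℝ) ^ β := by positivity
    by_cases h1 : t / a ≤ 1
    · simp only [hψ]
      rw [inner_eq_one h1, inner_deriv_eq_zero h1]
      nlinarith
    · push Not at h1
      have hs0 : 0 < t / a := by linarith
      rw [hform _ hs0]
      set s := t / a with hs_def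
      have hT0 := Real.smoothTransition.nonneg (s - 1)
      have hT1 := Real.smoothTransition.le_one (s - 1)
      have hT'0 : 0 ≤ deriv Real.smoothTransition (s - 1) :=
        Real.smoothTransition.monotone.deriv_nonneg
      have hT'D : deriv Real.smoothTransition (s - 1) ≤ D := le_trans (le_abs_self _) (hD _)
      -- the second term lies in `[0, 2D·2^β]`
      have hsec : 0 ≤ s * deriv Real.smoothTransition (s - 1) * ((s / 2) ^ (-β) - 1) ∧
          s * deriv Real.smoothTransition (s - 1) * ((s / 2) ^ (-β) - 1) ≤ 2 * D * 2 ^ β := by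
        by_cases h2 : s ≤ 2
        · have hg1 := hg_ge s hs0 h2
          have hg2 := hg_le s h1.le
          have h6 : 0 ≤ s * deriv Real.smoothTransition (s - 1) := mul_nonneg hs0.le hT'0
          have h3 : s * deriv Real.smoothTransition (s - 1) ≤ 2 * D := by nlinarith
          constructor
          · nlinarith
          · nlinarith
        · push Not at h2
          rw [Calculus.deriv_smoothTransition_of_one_le (by linarith), mul_zero, zero_mul]
          exact ⟨le_rfl, by positivity⟩
      have h1' : 0 ≤ β * (1 - Real.smoothTransition (s - 1)) := mul_nonneg hβ (by linarith)
      have h1'' : β * (1 - Real.smoothTransition (s - 1)) ≤ β := by nlinarith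
      nlinarith [hsec.1, hsec.2]
  · intro t ht
    rw [(hd t).deriv, abs_mul, abs_of_pos (by positivity : (0 : ℝ) < 1 / a)]
    have hbd := inner_abs_deriv_mul_le hβ hD0 hD (s := t / a) (by rwa [le_div_iff₀ ha, one_mul])
    calc |deriv ψ (t / a)| * (1 / a) * t = |deriv ψ (t / a)| * (t / a) := by
          field_simp
      _ ≤ (D + β) * (2 : ℝ) ^ (β + 1) := hbd

/-- **(Q1) The left integrand in the window, pointwise** (inner scale `a = 1/2`, outer
`Φ₂ = ((1 − t/b)₊)²`, `b ≥ 4`): with `Φ = Φ₁Φ₂`, `t = |y|²`,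
`κ(t)|U|² ≥ −K₁ 1_{|y| ≤ 1}|U|² + ½ (b/2)^{−β} 1_{b/4 ≤ t ≤ b/2… }` — here with the annulus
`A = {b/16 ≤ t ≤ b/4}` and the bound `(1/8)(b/4)^{−β}`. [folklore] -/
private theorem window_Q1 {β b K₁ : ℝ} {Φ₁ Φ₂ : ℝ → ℝ}
    (U : EuclideanSpace ℝ (Fin 3) → EuclideanSpace ℝ (Fin 3)) (hb : 16 ≤ b) (hβ : 0 ≤ β)
    (hΦ₁nn : ∀ t, 0 < t → 0 ≤ Φ₁ t) (hΦ₁two : ∀ t, 2 * (1 / 2) ≤ t → Φ₁ t = (t / (1 / 2) / 2) ^ (-β))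
    (hΦ₁sign : ∀ t, -(2 * β) * Φ₁ t - 2 * t * deriv Φ₁ t ≤ 0)
    (hΦ₁zero : ∀ t, 2 * (1 / 2) ≤ t → -(2 * β) * Φ₁ t - 2 * t * deriv Φ₁ t = 0)
    (hΦ₁low : ∀ t, -K₁ ≤ -(2 * β) * Φ₁ t - 2 * t * deriv Φ₁ t)
    (hΦ₂nn : ∀ t, 0 ≤ Φ₂ t) (hΦ₂le : ∀ t, 0 ≤ t → Φ₂ t ≤ 1) (hΦ₂d0 : ∀ t, deriv Φ₂ t ≤ 0)
    (hΦ₂low : ∀ t, t ≤ b / 2 → 1 / b ≤ -deriv Φ₂ t)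
    (hΦd : ∀ t, deriv (fun t => Φ₁ t * Φ₂ t) t = deriv Φ₁ t * Φ₂ t + Φ₁ t * deriv Φ₂ t)
    (y : EuclideanSpace ℝ (Fin 3)) :
    -K₁ * (closedBall (0 : EuclideanSpace ℝ (Fin 3)) 1).indicator (fun y => ‖U y‖ ^ 2) y +
      1 / 8 * (b / 4) ^ (-β) * ({y : EuclideanSpace ℝ (Fin 3) | b / 16 ≤ ‖y‖ ^ 2 ∧
        ‖y‖ ^ 2 ≤ b / 4}).indicator (fun y => ‖U y‖ ^ 2) y ≤
      ((-(2 * β)) * (Φ₁ (‖y‖ ^ 2) * Φ₂ (‖y‖ ^ 2)) -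
        2 * ‖y‖ ^ 2 * deriv (fun t => Φ₁ t * Φ₂ t) (‖y‖ ^ 2)) * ‖U y‖ ^ 2 := by
  have ht0 : 0 ≤ ‖y‖ ^ 2 := by positivity
  have hdecomp : ((-(2 * β)) * (Φ₁ (‖y‖ ^ 2) * Φ₂ (‖y‖ ^ 2)) -
      2 * ‖y‖ ^ 2 * deriv (fun t => Φ₁ t * Φ₂ t) (‖y‖ ^ 2)) * ‖U y‖ ^ 2 =
      (-(2 * β) * Φ₁ (‖y‖ ^ 2) - 2 * ‖y‖ ^ 2 * deriv Φ₁ (‖y‖ ^ 2)) * Φ₂ (‖y‖ ^ 2) *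
        ‖U y‖ ^ 2 + 2 * ‖y‖ ^ 2 * Φ₁ (‖y‖ ^ 2) * (-deriv Φ₂ (‖y‖ ^ 2)) * ‖U y‖ ^ 2 := by
    rw [hΦd]
    ring
  rw [hdecomp]
  gcongr ?_ + ?_
  · -- the defect term: `κ₁Φ₂|U|² ≥ −K₁ 1_{|y|≤1}|U|²`
    by_cases hy : y ∈ closedBall (0 : EuclideanSpace ℝ (Fin 3)) 1
    · rw [indicator_of_mem hy]
      have h1 : -K₁ ≤ (-(2 * β) * Φ₁ (‖y‖ ^ 2) - 2 * ‖y‖ ^ 2 * deriv Φ₁ (‖y‖ ^ 2)) *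
          Φ₂ (‖y‖ ^ 2) := by
        have hκ := hΦ₁low (‖y‖ ^ 2)
        have hκ0 := hΦ₁sign (‖y‖ ^ 2)
        have hK : 0 ≤ K₁ := by linarith
        have h2 := hΦ₂le _ ht0
        have h3 := hΦ₂nn (‖y‖ ^ 2)
        nlinarith
      nlinarith [sq_nonneg ‖U y‖]
    · rw [indicator_of_notMem hy, mul_zero]
      rw [mem_closedBall_zero_iff, not_le] at hy
      have h1 : 2 * (1 / 2) ≤ ‖y‖ ^ 2 := by nlinarith
      rw [hΦ₁zero _ h1, zero_mul, zero_mul]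
  · -- the annular term: `2tΦ₁(−Φ₂')|U|² ≥ (1/8)(b/4)^{−β} 1_A |U|²`
    have hw0 : 0 ≤ 2 * ‖y‖ ^ 2 * Φ₁ (‖y‖ ^ 2) * (-deriv Φ₂ (‖y‖ ^ 2)) * ‖U y‖ ^ 2 := by
      have h3 : 0 ≤ -deriv Φ₂ (‖y‖ ^ 2) := by linarith [hΦ₂d0 (‖y‖ ^ 2)]
      by_cases hy0 : y = 0
      · subst hy0
        simp
      · have : 0 < ‖y‖ ^ 2 := by positivity
        have h4 := hΦ₁nn _ this
        positivity
    by_cases hy : y ∈ {y : EuclideanSpace ℝ (Fin 3) | b / 16 ≤ ‖y‖ ^ 2 ∧ ‖y‖ ^ 2 ≤ b / 4}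
    · rw [indicator_of_mem hy]
      obtain ⟨hy1, hy2⟩ := hy
      have ht1 : 2 * (1 / 2) ≤ ‖y‖ ^ 2 := by linarith
      rw [hΦ₁two _ ht1, show ‖y‖ ^ 2 / (1 / 2) / 2 = ‖y‖ ^ 2 by ring]
      have hpow : (b / 4) ^ (-β) ≤ (‖y‖ ^ 2) ^ (-β) :=
        Real.rpow_le_rpow_of_nonpos (by linarith) hy2 (by linarith)
      have hpow0 : 0 ≤ (b / 4) ^ (-β) := Real.rpow_nonneg (by linarith) _
      have hd := hΦ₂low (‖y‖ ^ 2) (by linarith)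
      have hb0 : 0 < b := by linarith
      -- `2t(−Φ₂') ≥ 2(b/16)(1/b) = 1/8`
      have h5 : 1 / 8 ≤ 2 * ‖y‖ ^ 2 * (-deriv Φ₂ (‖y‖ ^ 2)) := by
        have e1 : (1 : ℝ) / 8 = 2 * (b / 16) * (1 / b) := by
          field_simp
          ring
        rw [e1]
        have h6 : 2 * (b / 16) ≤ 2 * ‖y‖ ^ 2 := by linarith
        have h7 : 0 ≤ 1 / b := by positivity
        exact mul_le_mul h6 hd h7 (by positivity)
      calc 1 / 8 * (b / 4) ^ (-β) * ‖U y‖ ^ 2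
          ≤ (2 * ‖y‖ ^ 2 * (-deriv Φ₂ (‖y‖ ^ 2))) * (‖y‖ ^ 2) ^ (-β) * ‖U y‖ ^ 2 := by
            gcongr
        _ = 2 * ‖y‖ ^ 2 * (‖y‖ ^ 2) ^ (-β) * (-deriv Φ₂ (‖y‖ ^ 2)) * ‖U y‖ ^ 2 := by ring
    · rw [indicator_of_notMem hy, mul_zero]
      exact hw0

/-- **(Q2) The flux integrand in the window, pointwise**: `|Φ'(|y|²)| |y| ≤ 2K₂ + 2^β`
(`t|Φ₁'| ≤ K₂` on `t ≥ 1/2` and `Φ₁' = 0` below; `Φ₁ ≤ 2^β`, `|Φ₂'| |y| ≤ (2/b)(b/2) = 1` on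
`t < b` for `b ≥ 4`). [folklore] -/
private theorem window_Q2 {β b K₂ : ℝ} {Φ₁ Φ₂ : ℝ → ℝ}
    (U : EuclideanSpace ℝ (Fin 3) → EuclideanSpace ℝ (Fin 3)) (P : EuclideanSpace ℝ (Fin 3) → ℝ)
    (hb : 4 ≤ b) (hK₂ : 0 ≤ K₂)
    (hΦ₁d0 : ∀ t, t ≤ 1 / 2 → deriv Φ₁ t = 0)
    (hΦ₁dec : ∀ t, 1 / 2 ≤ t → |deriv Φ₁ t| * t ≤ K₂)
    (hΦ₁nn : ∀ t, 0 < t → 0 ≤ Φ₁ t) (hΦ₁bd : ∀ t, 0 < t → Φ₁ t ≤ (2 : ℝ) ^ β)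
    (hΦ₂nn : ∀ t, 0 ≤ Φ₂ t) (hΦ₂le : ∀ t, 0 ≤ t → Φ₂ t ≤ 1)
    (hΦ₂dle : ∀ t, 0 ≤ t → |deriv Φ₂ t| ≤ 2 / b) (hΦ₂d_b : ∀ t, b ≤ t → deriv Φ₂ t = 0)
    (hΦd : ∀ t, deriv (fun t => Φ₁ t * Φ₂ t) t = deriv Φ₁ t * Φ₂ t + Φ₁ t * deriv Φ₂ t)
    (y : EuclideanSpace ℝ (Fin 3)) :
    ‖(‖U y‖ ^ 2 + 2 * P y) * (2 * deriv (fun t => Φ₁ t * Φ₂ t) (‖y‖ ^ 2) * ⟪y, U y⟫)‖ ≤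
      2 * (2 * K₂ + (2 : ℝ) ^ β) * (‖U y‖ ^ 3 + 2 * (|P y| * ‖U y‖)) := by
  have ht0 : 0 ≤ ‖y‖ ^ 2 := by positivity
  have hb0 : 0 < b := by linarith
  have h2β : 0 < (2 : ℝ) ^ β := Real.rpow_pos_of_pos two_pos _
  -- inner part
  have hT1 : |deriv Φ₁ (‖y‖ ^ 2) * Φ₂ (‖y‖ ^ 2)| * ‖y‖ ≤ 2 * K₂ := by
    by_cases hta : ‖y‖ ^ 2 ≤ 1 / 2
    · rw [hΦ₁d0 _ hta, zero_mul, abs_zero, zero_mul]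
      positivity
    · push Not at hta
      have hy0 : 1 / 2 < ‖y‖ := by nlinarith [norm_nonneg y]
      have hy0' : 0 < ‖y‖ := by linarith
      have hbd := hΦ₁dec (‖y‖ ^ 2) hta.le
      calc |deriv Φ₁ (‖y‖ ^ 2) * Φ₂ (‖y‖ ^ 2)| * ‖y‖
          ≤ |deriv Φ₁ (‖y‖ ^ 2)| * 1 * ‖y‖ := by
            rw [abs_mul]
            gcongr
            rw [abs_of_nonneg (hΦ₂nn _)]
            exact hΦ₂le _ ht0
        _ = |deriv Φ₁ (‖y‖ ^ 2)| * ‖y‖ ^ 2 / ‖y‖ := by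
            field_simp
        _ ≤ K₂ / ‖y‖ := by gcongr
        _ ≤ K₂ / (1 / 2) := by gcongr
        _ = 2 * K₂ := by ring
  -- outer part
  have hT2 : |Φ₁ (‖y‖ ^ 2) * deriv Φ₂ (‖y‖ ^ 2)| * ‖y‖ ≤ (2 : ℝ) ^ β := by
    by_cases hy0 : ‖y‖ = 0
    · rw [hy0, mul_zero]
      exact h2β.le
    have hy0' : 0 < ‖y‖ := lt_of_le_of_ne (norm_nonneg _) (Ne.symm hy0)
    have ht0' : 0 < ‖y‖ ^ 2 := by positivity
    by_cases h2 : b ≤ ‖y‖ ^ 2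
    · rw [hΦ₂d_b _ h2, mul_zero, abs_zero, zero_mul]
      exact h2β.le
    push Not at h2
    have hyl : 2 * ‖y‖ ≤ b := by nlinarith [norm_nonneg y]
    rw [abs_mul, abs_of_nonneg (hΦ₁nn _ ht0')]
    calc Φ₁ (‖y‖ ^ 2) * |deriv Φ₂ (‖y‖ ^ 2)| * ‖y‖ ≤ (2 : ℝ) ^ β * (2 / b) * ‖y‖ := by
          gcongr
          · exact hΦ₁bd _ ht0'
          · exact hΦ₂dle _ ht0
      _ = (2 : ℝ) ^ β * (2 * ‖y‖ / b) := by ring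
      _ ≤ (2 : ℝ) ^ β * 1 := by
          gcongr
          rw [div_le_one hb0]
          exact hyl
      _ = (2 : ℝ) ^ β := mul_one _
  have hDφ : |deriv (fun t => Φ₁ t * Φ₂ t) (‖y‖ ^ 2)| * ‖y‖ ≤ 2 * K₂ + (2 : ℝ) ^ β := by
    rw [hΦd]
    calc |deriv Φ₁ (‖y‖ ^ 2) * Φ₂ (‖y‖ ^ 2) + Φ₁ (‖y‖ ^ 2) * deriv Φ₂ (‖y‖ ^ 2)| * ‖y‖
        ≤ (|deriv Φ₁ (‖y‖ ^ 2) * Φ₂ (‖y‖ ^ 2)| + |Φ₁ (‖y‖ ^ 2) * deriv Φ₂ (‖y‖ ^ 2)|) *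
            ‖y‖ := by
          gcongr
          exact abs_add_le _ _
      _ ≤ 2 * K₂ + (2 : ℝ) ^ β := by
          rw [add_mul]
          exact add_le_add hT1 hT2
  rw [Real.norm_eq_abs, abs_mul, abs_mul, abs_mul]
  have hin : |⟪y, U y⟫| ≤ ‖y‖ * ‖U y‖ := abs_real_inner_le_norm _ _
  have hA : |‖U y‖ ^ 2 + 2 * P y| ≤ ‖U y‖ ^ 2 + 2 * |P y| := by
    calc |‖U y‖ ^ 2 + 2 * P y| ≤ |‖U y‖ ^ 2| + |2 * P y| := abs_add_le _ _
      _ = ‖U y‖ ^ 2 + 2 * |P y| := by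
          rw [abs_of_nonneg (by positivity), abs_mul, abs_two]
  calc |‖U y‖ ^ 2 + 2 * P y| * (|2| * |deriv (fun t => Φ₁ t * Φ₂ t) (‖y‖ ^ 2)| * |⟪y, U y⟫|)
      ≤ (‖U y‖ ^ 2 + 2 * |P y|) *
          (2 * |deriv (fun t => Φ₁ t * Φ₂ t) (‖y‖ ^ 2)| * (‖y‖ * ‖U y‖)) := by
        rw [abs_two]
        gcongr
    _ = (‖U y‖ ^ 2 + 2 * |P y|) * ‖U y‖ *
          (2 * (|deriv (fun t => Φ₁ t * Φ₂ t) (‖y‖ ^ 2)| * ‖y‖)) := by ring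
    _ ≤ (‖U y‖ ^ 2 + 2 * |P y|) * ‖U y‖ * (2 * (2 * K₂ + (2 : ℝ) ^ β)) := by gcongr
    _ = 2 * (2 * K₂ + (2 : ℝ) ^ β) * (‖U y‖ ^ 3 + 2 * (|P y| * ‖U y‖)) := by ring

/-- **The annular energy bound in the window** (CS13 §3.2.3 at `p = 3`, in closed form): for
`1 ≤ α ≤ 3/2`, `U ∈ L³`, `P ∈ L^{3/2}` there is `C` with
`∫_{L²/16 ≤ |y|² ≤ L²/4} |U|² ≤ C L^{3−2α}` for every `L ≥ 4`: the radial local energy identity with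
`Φ = Φ₁Φ₂`, `Φ₁ = ψ_β(2t)` (inner scale `1/2`), `Φ₂ = ((1 − t/L²)₊)²`, the (now favourable)
large-scale term kept on the left and the defect of the fixed inner scale bounded by the core
energy (CS13's "`l₁ = 2` fixed", (3.17)). [cite: ChaeShvydkoy2013, §3.2.3 Cor. 3.4 (p = 3)] -/
theorem IsSelfSimilarEulerProfile.annular_energy_le_of_window {α : ℝ}
    {U : EuclideanSpace ℝ (Fin 3) → EuclideanSpace ℝ (Fin 3)} {P : EuclideanSpace ℝ (Fin 3) → ℝ}
    (h : IsSelfSimilarEulerProfile (1 / (α + 1)) 0 U P) (hα : 1 ≤ α) (hα1 : α ≤ 3 / 2)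
    (hU3 : MemLp U 3 volume) (hP : MemLp P (3 / 2 : ℝ≥0∞) volume) :
    ∃ C : ℝ, ∀ L : ℝ, 4 ≤ L →
      ∫ y in {y : EuclideanSpace ℝ (Fin 3) | L ^ 2 / 16 ≤ ‖y‖ ^ 2 ∧ ‖y‖ ^ 2 ≤ L ^ 2 / 4},
        ‖U y‖ ^ 2 ≤ C * L ^ (3 - 2 * α) := by
  have hα0 : α + 1 ≠ 0 := by
    intro h0
    linarith
  have hUc : Continuous U := h.contDiff_velocity.continuous
  obtain ⟨D, hD0, hD⟩ := Calculus.exists_bound_deriv_smoothTransition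
  set β : ℝ := 3 / 2 - α with hβ_def
  have hβ0 : 0 ≤ β := by rw [hβ_def]; linarith
  obtain ⟨Φ₁, hΦ₁1, hΦ₁d0, hΦ₁nn, hΦ₁bd, hΦ₁two, hΦ₁sign, hΦ₁zero, hΦ₁low, hΦ₁dec⟩ :=
    exists_innerCut₂ (β := β) (a := 1 / 2) hβ0 (by norm_num) hD0 hD
  have hflux := integrable_flux hU3 hP
  set If : ℝ := ∫ y, (‖U y‖ ^ 3 + 2 * (|P y| * ‖U y‖)) with hIf_def
  have hIf : 0 ≤ If := integral_nonneg fun y => by positivity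
  set K₂ : ℝ := (D + β) * (2 : ℝ) ^ (β + 1) with hK₂_def
  have hK₂ : 0 ≤ K₂ := by positivity
  set K₁ : ℝ := 2 * β + 4 * D * (2 : ℝ) ^ β with hK₁_def
  have hK₁ : 0 ≤ K₁ := by positivity
  set Kf : ℝ := 2 * (2 * K₂ + (2 : ℝ) ^ β) with hKf_def
  have hKf : 0 ≤ Kf := by positivity
  set Ecore : ℝ := ∫ y in closedBall (0 : EuclideanSpace ℝ (Fin 3)) 1, ‖U y‖ ^ 2 with hEcore_def
  have hEcore : 0 ≤ Ecore := integral_nonneg fun y => by positivity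
  refine ⟨8 * (K₁ * Ecore + (1 + α) * (Kf * If)), fun L hL => ?_⟩
  have hL0 : 0 < L := by linarith
  set b : ℝ := L ^ 2 with hb_def
  have hb : 0 < b := by positivity
  have hb16 : 16 ≤ b := by rw [hb_def]; nlinarith
  obtain ⟨Φ₂, hΦ₂1, hΦ₂zero, hΦ₂nn, hΦ₂le, hΦ₂d0, hΦ₂dle, hΦ₂d_b, hΦ₂low⟩ := exists_polyCut hb
  have hΦ1 : ContDiff ℝ 1 (fun t => Φ₁ t * Φ₂ t) := hΦ₁1.mul hΦ₂1
  have hΦT : ∀ t, b ≤ t → (fun t => Φ₁ t * Φ₂ t) t = 0 := fun t ht => by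
    simp only [hΦ₂zero t ht, mul_zero]
  have hΦd : ∀ t, deriv (fun t => Φ₁ t * Φ₂ t) t = deriv Φ₁ t * Φ₂ t + Φ₁ t * deriv Φ₂ t :=
    fun t => ((((hΦ₁1.differentiable one_ne_zero) t).hasDerivAt).mul
      (((hΦ₂1.differentiable one_ne_zero) t).hasDerivAt)).deriv
  have key := h.localEnergy_identity_radial hα0 hΦ1 hΦT
  beta_reduce at key
  rw [show 2 * α - 3 = -(2 * β) by rw [hβ_def]; ring] at key
  -- pointwise bounds
  set A : Set (EuclideanSpace ℝ (Fin 3)) := {y | b / 16 ≤ ‖y‖ ^ 2 ∧ ‖y‖ ^ 2 ≤ b / 4} with hA_def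
  have hQ1 := window_Q1 U hb16 hβ0 hΦ₁nn hΦ₁two hΦ₁sign hΦ₁zero hΦ₁low hΦ₂nn hΦ₂le hΦ₂d0
    hΦ₂low hΦd
  have hQ2 := window_Q2 U P (by linarith : (4 : ℝ) ≤ b) hK₂ hΦ₁d0 hΦ₁dec hΦ₁nn hΦ₁bd hΦ₂nn
    hΦ₂le hΦ₂dle hΦ₂d_b hΦd
  -- integrability
  have hAmeas : MeasurableSet A :=
    (isClosed_le continuous_const (continuous_norm.pow 2)).measurableSet.inter
      (isClosed_le (continuous_norm.pow 2) continuous_const).measurableSet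
  have hAsub : A ⊆ closedBall (0 : EuclideanSpace ℝ (Fin 3)) L := fun y hy => by
    rw [mem_closedBall_zero_iff]
    have h2 : ‖y‖ ^ 2 ≤ L ^ 2 := by
      have := hy.2
      rw [hb_def] at this
      nlinarith [sq_nonneg L]
    exact (pow_le_pow_iff_left₀ (norm_nonneg _) hL0.le two_ne_zero).1 h2
  have hsuppL : ∀ {g : EuclideanSpace ℝ (Fin 3) → ℝ}, (∀ y, b ≤ ‖y‖ ^ 2 → g y = 0) →
      HasCompactSupport g := by
    intro g hg
    refine HasCompactSupport.intro (isCompact_closedBall (0 : EuclideanSpace ℝ (Fin 3)) L)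
      fun y hy => hg y ?_
    rw [mem_closedBall_zero_iff, not_le] at hy
    rw [hb_def]
    exact pow_le_pow_left₀ hL0.le hy.le 2
  have hderiv_b : ∀ t, b ≤ t → deriv (fun t => Φ₁ t * Φ₂ t) t = 0 := by
    intro t ht
    rw [hΦd t, hΦ₂d_b t ht, hΦ₂zero t ht]
    ring
  have hiL : Integrable (fun y : EuclideanSpace ℝ (Fin 3) =>
      ((-(2 * β)) * (Φ₁ (‖y‖ ^ 2) * Φ₂ (‖y‖ ^ 2)) -
        2 * ‖y‖ ^ 2 * deriv (fun t => Φ₁ t * Φ₂ t) (‖y‖ ^ 2)) * ‖U y‖ ^ 2) := by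
    have hc1 : Continuous fun y : EuclideanSpace ℝ (Fin 3) => Φ₁ (‖y‖ ^ 2) * Φ₂ (‖y‖ ^ 2) :=
      hΦ1.continuous.comp (continuous_norm.pow 2)
    have hc2 : Continuous fun y : EuclideanSpace ℝ (Fin 3) =>
        deriv (fun t => Φ₁ t * Φ₂ t) (‖y‖ ^ 2) :=
      hΦ1.continuous_deriv_one.comp (continuous_norm.pow 2)
    refine (((continuous_const.mul hc1).sub
      ((continuous_const.mul (continuous_norm.pow 2)).mul hc2)).mul (hUc.norm.pow 2))
      |>.integrable_of_hasCompactSupport (hsuppL fun y hy => ?_)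
    simp only [Pi.mul_apply, Pi.sub_apply, Pi.pow_apply]
    rw [hderiv_b _ hy, hΦ₂zero _ hy]
    ring
  have hint_ball : ∀ (s : Set (EuclideanSpace ℝ (Fin 3))), s ⊆ closedBall 0 L → MeasurableSet s →
      Integrable (fun y => s.indicator (fun y => ‖U y‖ ^ 2) y)
        (volume : Measure (EuclideanSpace ℝ (Fin 3))) := fun s hs hsm =>
    (((hUc.norm.pow 2).continuousOn.integrableOn_compact
      (isCompact_closedBall (0 : EuclideanSpace ℝ (Fin 3)) L)).mono_set hs).integrable_indicator
      hsm
  have hcore_sub : closedBall (0 : EuclideanSpace ℝ (Fin 3)) 1 ⊆ closedBall 0 L :=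
    closedBall_subset_closedBall (by linarith)
  have hiQ : Integrable (fun y => -K₁ * (closedBall (0 : EuclideanSpace ℝ (Fin 3)) 1).indicator
      (fun y => ‖U y‖ ^ 2) y + 1 / 8 * (b / 4) ^ (-β) * A.indicator (fun y => ‖U y‖ ^ 2) y)
      (volume : Measure (EuclideanSpace ℝ (Fin 3))) :=
    ((hint_ball _ hcore_sub measurableSet_closedBall).const_mul _).add
      ((hint_ball _ hAsub hAmeas).const_mul _)
  -- integrate Q1
  have hI1 : -K₁ * Ecore + 1 / 8 * (b / 4) ^ (-β) * ∫ y in A, ‖U y‖ ^ 2 ≤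
      ∫ y : EuclideanSpace ℝ (Fin 3), ((-(2 * β)) * (Φ₁ (‖y‖ ^ 2) * Φ₂ (‖y‖ ^ 2)) -
        2 * ‖y‖ ^ 2 * deriv (fun t => Φ₁ t * Φ₂ t) (‖y‖ ^ 2)) * ‖U y‖ ^ 2 := by
    rw [hEcore_def, ← integral_indicator measurableSet_closedBall, ← integral_indicator hAmeas,
      ← integral_const_mul, ← integral_const_mul,
      ← integral_add ((hint_ball _ hcore_sub measurableSet_closedBall).const_mul _)
        ((hint_ball _ hAsub hAmeas).const_mul _)]
    exact integral_mono hiQ hiL hQ1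
  -- the flux
  have hup : ‖∫ y, (‖U y‖ ^ 2 + 2 * P y) *
        (2 * deriv (fun t => Φ₁ t * Φ₂ t) (‖y‖ ^ 2) * ⟪y, U y⟫)‖ ≤ Kf * If := by
    rw [hIf_def, ← integral_const_mul]
    exact norm_integral_le_of_norm_le (hflux.const_mul _) (Eventually.of_forall hQ2)
  have hα' : 0 ≤ 1 + α := by linarith
  have hmain : 1 / 8 * (b / 4) ^ (-β) * ∫ y in A, ‖U y‖ ^ 2 ≤
      K₁ * Ecore + (1 + α) * (Kf * If) := by
    have h2 : (1 + α) * ∫ y, (‖U y‖ ^ 2 + 2 * P y) *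
        (2 * deriv (fun t => Φ₁ t * Φ₂ t) (‖y‖ ^ 2) * ⟪y, U y⟫) ≤ (1 + α) * (Kf * If) :=
      mul_le_mul_of_nonneg_left ((Real.le_norm_self _).trans hup) hα'
    linarith [hI1, key, h2]
  -- solve for the annular energy
  have hw : 0 < (b / 4) ^ (-β) := Real.rpow_pos_of_pos (by positivity) _
  have hwinv : ((b / 4) ^ (-β))⁻¹ = (b / 4) ^ β := by
    rw [Real.rpow_neg (by positivity), inv_inv]
  have hpow : (b / 4) ^ β ≤ L ^ (3 - 2 * α) := by
    calc (b / 4) ^ β ≤ b ^ β := Real.rpow_le_rpow (by positivity) (by linarith) hβ0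
      _ = L ^ (3 - 2 * α) := by
          rw [hb_def, ← Real.rpow_natCast, ← Real.rpow_mul hL0.le]
          congr 1
          rw [hβ_def]
          push_cast
          ring
  have hX0 : 0 ≤ ∫ y in A, ‖U y‖ ^ 2 := integral_nonneg fun y => by positivity
  have hM0 : 0 ≤ K₁ * Ecore + (1 + α) * (Kf * If) := by positivity
  calc ∫ y in A, ‖U y‖ ^ 2
      = 8 * (b / 4) ^ β * (1 / 8 * (b / 4) ^ (-β) * ∫ y in A, ‖U y‖ ^ 2) := by
        rw [← hwinv]
        field_simp
    _ ≤ 8 * (b / 4) ^ β * (K₁ * Ecore + (1 + α) * (Kf * If)) := by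
        gcongr
    _ ≤ 8 * L ^ (3 - 2 * α) * (K₁ * Ecore + (1 + α) * (Kf * If)) := by
        gcongr
    _ = 8 * (K₁ * Ecore + (1 + α) * (Kf * If)) * L ^ (3 - 2 * α) := by ring

/-- **Dyadic summation.** If `E : ℝ → ℝ` satisfies `E ρ ≤ E 2` for `0 ≤ ρ ≤ 2` and
`E ρ ≤ E (ρ/2) + C₁ ρ^e` for `ρ ≥ 2`, with `e > 0`, `C₁ ≥ 0`, then
`E ρ ≤ E 2 + C₁ ρ^e / (1 − 2^{−e})` for all `ρ ≥ 0`. [folklore] -/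
private theorem dyadic_growth {E : ℝ → ℝ} {C₁ e : ℝ} (he : 0 < e) (hC₁ : 0 ≤ C₁)
    (hbase : ∀ ρ, 0 ≤ ρ → ρ ≤ 2 → E ρ ≤ E 2)
    (hrec : ∀ ρ, 2 ≤ ρ → E ρ ≤ E (ρ / 2) + C₁ * ρ ^ e) :
    ∀ ρ, 0 ≤ ρ → E ρ ≤ E 2 + C₁ * (1 - (2 : ℝ) ^ (-e))⁻¹ * ρ ^ e := by
  have hq : (2 : ℝ) ^ (-e) < 1 := Real.rpow_lt_one_of_one_lt_of_neg (by norm_num) (by linarith)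
  have hq0 : 0 < (2 : ℝ) ^ (-e) := Real.rpow_pos_of_pos two_pos _
  set S : ℝ := (1 - (2 : ℝ) ^ (-e))⁻¹ with hS_def
  have hS0 : 0 < S := by rw [hS_def]; exact inv_pos.2 (by linarith)
  have hS1 : 1 ≤ S := by
    rw [hS_def]
    exact one_le_inv_iff₀.2 ⟨by linarith, by linarith⟩
  have hSid : (2 : ℝ) ^ (-e) * S + 1 = S := by
    have hne : (1 : ℝ) - 2 ^ (-e) ≠ 0 := by linarith
    rw [hS_def]
    field_simp
    ring
  -- induction on the dyadic level
  have claim : ∀ n : ℕ, ∀ ρ, 0 ≤ ρ → ρ ≤ 2 * 2 ^ n → E ρ ≤ E 2 + C₁ * S * ρ ^ e := by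
    intro n
    induction n with
    | zero =>
      intro ρ hρ0 hρ
      have h1 := hbase ρ hρ0 (by simpa using hρ)
      have h2 : 0 ≤ C₁ * S * ρ ^ e := by
        have := Real.rpow_nonneg hρ0 e
        positivity
      linarith
    | succ n ih =>
      intro ρ hρ0 hρ
      by_cases h2 : ρ ≤ 2
      · have h1 := hbase ρ hρ0 h2
        have h3 : 0 ≤ C₁ * S * ρ ^ e := by
          have := Real.rpow_nonneg hρ0 e
          positivity
        linarith
      · push Not at h2
        have hih := ih (ρ / 2) (by positivity) (by rw [pow_succ] at hρ; linarith)
        have hr := hrec ρ h2.le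
        have hhalf : (ρ / 2) ^ e = ρ ^ e * (2 : ℝ) ^ (-e) := by
          rw [Real.div_rpow hρ0 (by norm_num), Real.rpow_neg (by norm_num), div_eq_mul_inv]
        rw [hhalf] at hih
        have hρe : 0 ≤ ρ ^ e := Real.rpow_nonneg hρ0 e
        calc E ρ ≤ E (ρ / 2) + C₁ * ρ ^ e := hr
          _ ≤ E 2 + C₁ * S * (ρ ^ e * (2 : ℝ) ^ (-e)) + C₁ * ρ ^ e := by linarith
          _ = E 2 + C₁ * ((2 : ℝ) ^ (-e) * S + 1) * ρ ^ e := by ring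
          _ = E 2 + C₁ * S * ρ ^ e := by rw [hSid]
  intro ρ hρ0
  obtain ⟨n, hn⟩ := pow_unbounded_of_one_lt ρ (by norm_num : (1 : ℝ) < 2)
  exact claim n ρ hρ0 (by linarith [pow_pos (two_pos : (0 : ℝ) < 2) n])

/-- **Chae–Shvydkoy 2013, Corollary 3.4 at `p = 3` in the open window `1 < α < 3/2`, proved.**
A stationary self-similar Euler profile `(U, P)` with exponent `γ = 1/(α+1)`, `1 < α < 3/2`
(`2/5 < c_l = γ < 1/2`), `U ∈ C² ∩ L³(ℝ³)`, `P ∈ L^{3/2}(ℝ³)` has the energy growth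
`∫_{|y|<L} |U|² ≤ C L^{3−2α}` for all `L ≥ L₀` — CS13 (3.20) = (1.3), "a natural internal feature
of the blow-up, independent of the total energy assumption". Proof: the annular bound
`annular_energy_le_of_window` summed over dyadic shells (`dyadic_growth`; the geometric series
converges because `3 − 2α > 0`). Not covered here: the endpoint `α = 3/2` (CS13 §3.2.3 treats the
logarithm separately) and `3 < p < ∞`; these remain the named fact
`chaeShvydkoy2013_energy_growth`. [cite: ChaeShvydkoy2013, §3.2.3 Cor. 3.4 (p = 3, N/p < α < N/2)] -/
theorem IsSelfSimilarEulerProfile.energyGrowth_of_memLp_three_of_window {α : ℝ}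
    {U : EuclideanSpace ℝ (Fin 3) → EuclideanSpace ℝ (Fin 3)} {P : EuclideanSpace ℝ (Fin 3) → ℝ}
    (h : IsSelfSimilarEulerProfile (1 / (α + 1)) 0 U P) (hα : 1 < α) (hα1 : α < 3 / 2)
    (hU3 : MemLp U 3 volume) (hP : MemLp P (3 / 2 : ℝ≥0∞) volume) :
    ∃ C L₀ : ℝ, 0 < L₀ ∧ ∀ L : ℝ, L₀ ≤ L →
      ∫ y in ball (0 : EuclideanSpace ℝ (Fin 3)) L, ‖U y‖ ^ 2 ≤ C * L ^ (3 - 2 * α) := by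
  have hUc : Continuous U := h.contDiff_velocity.continuous
  obtain ⟨C, hC⟩ := h.annular_energy_le_of_window hα.le hα1.le hU3 hP
  set e : ℝ := 3 - 2 * α with he_def
  have he : 0 < e := by rw [he_def]; linarith
  set E : ℝ → ℝ := fun ρ => ∫ y in ball (0 : EuclideanSpace ℝ (Fin 3)) ρ, ‖U y‖ ^ 2 with hE_def
  have hint : ∀ ρ, IntegrableOn (fun y => ‖U y‖ ^ 2) (ball (0 : EuclideanSpace ℝ (Fin 3)) ρ)
      volume := fun ρ =>
    ((hUc.norm.pow 2).continuousOn.integrableOn_compact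
      (isCompact_closedBall (0 : EuclideanSpace ℝ (Fin 3)) ρ)).mono_set ball_subset_closedBall
  have hmono : ∀ ρ₁ ρ₂, ρ₁ ≤ ρ₂ → E ρ₁ ≤ E ρ₂ := fun ρ₁ ρ₂ h12 =>
    setIntegral_mono_set (hint ρ₂) (ae_of_all _ fun y => by positivity)
      (ae_of_all _ (ball_subset_ball h12))
  -- `C ≥ 0` (test the annular bound at `L = 4`)
  have hC0 : 0 ≤ C := by
    have h4 := hC 4 le_rfl
    have h0 : 0 ≤ ∫ y in {y : EuclideanSpace ℝ (Fin 3) | (4 : ℝ) ^ 2 / 16 ≤ ‖y‖ ^ 2 ∧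
        ‖y‖ ^ 2 ≤ (4 : ℝ) ^ 2 / 4}, ‖U y‖ ^ 2 := integral_nonneg fun y => by positivity
    have hp : 0 < (4 : ℝ) ^ (3 - 2 * α) := Real.rpow_pos_of_pos (by norm_num) _
    nlinarith
  -- the recursion `E ρ ≤ E (ρ/2) + C 2^e ρ^e` for `ρ ≥ 2`
  have hrec : ∀ ρ, 2 ≤ ρ → E ρ ≤ E (ρ / 2) + C * (2 : ℝ) ^ e * ρ ^ e := by
    intro ρ hρ
    have hρ0 : 0 < ρ := by linarith
    have hann := hC (2 * ρ) (by linarith)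
    rw [show (2 * ρ) ^ 2 / 16 = ρ ^ 2 / 4 by ring, show (2 * ρ) ^ 2 / 4 = ρ ^ 2 by ring,
      Real.mul_rpow (by norm_num) hρ0.le] at hann
    -- split the ball
    have hsplit : ball (0 : EuclideanSpace ℝ (Fin 3)) ρ =
        ball 0 (ρ / 2) ∪ (ball 0 ρ \ ball 0 (ρ / 2)) := by
      ext y
      constructor
      · intro hy
        by_cases h' : y ∈ ball (0 : EuclideanSpace ℝ (Fin 3)) (ρ / 2)
        · exact Or.inl h'
        · exact Or.inr ⟨hy, h'⟩
      · rintro (h' | h')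
        · exact ball_subset_ball (by linarith) h'
        · exact h'.1
    have hdisj : Disjoint (ball (0 : EuclideanSpace ℝ (Fin 3)) (ρ / 2)) (ball 0 ρ \ ball 0 (ρ / 2)) :=
      disjoint_sdiff_right
    have hsub : ball (0 : EuclideanSpace ℝ (Fin 3)) ρ \ ball 0 (ρ / 2) ⊆
        {y : EuclideanSpace ℝ (Fin 3) | ρ ^ 2 / 4 ≤ ‖y‖ ^ 2 ∧ ‖y‖ ^ 2 ≤ ρ ^ 2} := by
      intro y hy
      obtain ⟨hy1, hy2⟩ := hy
      rw [mem_ball_zero_iff] at hy1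
      rw [mem_ball_zero_iff, not_lt] at hy2
      constructor
      · nlinarith [hy2, norm_nonneg y]
      · nlinarith [hy1, norm_nonneg y]
    have hint' : IntegrableOn (fun y => ‖U y‖ ^ 2)
        {y : EuclideanSpace ℝ (Fin 3) | ρ ^ 2 / 4 ≤ ‖y‖ ^ 2 ∧ ‖y‖ ^ 2 ≤ ρ ^ 2} volume := by
      refine ((hUc.norm.pow 2).continuousOn.integrableOn_compact
        (isCompact_closedBall (0 : EuclideanSpace ℝ (Fin 3)) ρ)).mono_set fun y hy => ?_
      rw [mem_closedBall_zero_iff]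
      exact (pow_le_pow_iff_left₀ (norm_nonneg _) hρ0.le two_ne_zero).1 hy.2
    calc E ρ = ∫ y in ball (0 : EuclideanSpace ℝ (Fin 3)) (ρ / 2) ∪ (ball 0 ρ \ ball 0 (ρ / 2)),
          ‖U y‖ ^ 2 := by rw [hE_def]; simp only; rw [← hsplit]
      _ = E (ρ / 2) + ∫ y in ball (0 : EuclideanSpace ℝ (Fin 3)) ρ \ ball 0 (ρ / 2), ‖U y‖ ^ 2 :=
          setIntegral_union hdisj (measurableSet_ball.diff measurableSet_ball) (hint _)
            ((hint ρ).mono_set fun y hy => hy.1)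
      _ ≤ E (ρ / 2) + ∫ y in {y : EuclideanSpace ℝ (Fin 3) | ρ ^ 2 / 4 ≤ ‖y‖ ^ 2 ∧
          ‖y‖ ^ 2 ≤ ρ ^ 2}, ‖U y‖ ^ 2 :=
          add_le_add_right (setIntegral_mono_set hint' (ae_of_all _ fun y => by positivity)
            (ae_of_all _ hsub)) _
      _ ≤ E (ρ / 2) + C * (2 : ℝ) ^ e * ρ ^ e := by
          rw [he_def]
          linarith [hann]
  have hdy := dyadic_growth (E := E) he (by positivity : 0 ≤ C * (2 : ℝ) ^ e)
    (fun ρ _ hρ2 => hmono ρ 2 hρ2) hrec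
  -- conclusion for `L ≥ 2`: `E L ≤ E 2 + C' L^e ≤ (E 2 / 2^e + C') L^e`
  set C' : ℝ := C * (2 : ℝ) ^ e * (1 - (2 : ℝ) ^ (-e))⁻¹ with hC'_def
  have hE2 : 0 ≤ E 2 := integral_nonneg fun y => by positivity
  refine ⟨E 2 / (2 : ℝ) ^ e + C', 2, two_pos, fun L hL => ?_⟩
  have hL0 : 0 ≤ L := by linarith
  have h1 := hdy L hL0
  have h2e : 0 < (2 : ℝ) ^ e := Real.rpow_pos_of_pos two_pos _
  have hLe : (2 : ℝ) ^ e ≤ L ^ e := Real.rpow_le_rpow (by norm_num) hL he.le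
  have h3 : E 2 ≤ E 2 / (2 : ℝ) ^ e * L ^ e := by
    rw [div_mul_eq_mul_div, le_div_iff₀ h2e]
    exact mul_le_mul_of_nonneg_left hLe hE2
  calc E L ≤ E 2 + C * (2 : ℝ) ^ e * (1 - (2 : ℝ) ^ (-e))⁻¹ * L ^ e := h1
    _ ≤ E 2 / (2 : ℝ) ^ e * L ^ e + C' * L ^ e := by rw [hC'_def]; linarith
    _ = (E 2 / (2 : ℝ) ^ e + C') * L ^ (3 - 2 * α) := by rw [he_def]; ring

end Literature.Analysis.FluidPDE
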